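import Literature.NumberTheory.Automorphic.CDTTheorem712
import Literature.NumberTheory.EllipticCurves.ModFiveCongruenceHesseFamily
import Literature.NumberTheory.GaloisRepresentations.AbsGaloisGroup
import HarnessLib
import Literature.NumberTheory.EllipticCurves.LeadingTermBSZOrdinaryProofs
import Literature.NumberTheory.EllipticCurves.CongruentNumberCurveJacobiSums
import Literature.NumberTheory.EllipticCurves.GlobalMinimalModelProofs
import Literature.NumberTheory.EllipticCurves.WeilPairingProofs
import Literature.NumberTheory.EllipticCurves.DivisionField
import Mathlib.NumberTheory.LSeries.PrimesInAP
import Literature.NumberTheory.EllipticCurves.ModPIrreducibleCongruenceTransferProofs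
import Literature.NumberTheory.EllipticCurves.GeomReductionFrobeniusProofs
import Literature.NumberTheory.EllipticCurves.HeightFamily
import Literature.NumberTheory.GaloisRepresentations.ChebotarevOpenSubgroup
import Literature.NumberTheory.GaloisRepresentations.ArtinRestriction
import Literature.NumberTheory.GaloisRepresentations.HeckeCharacterProofs
import Literature.AlgebraicGeometry.Motives.ZetaFunctionProofs
import Mathlib.NumberTheory.Padics.HeightOneSpectrum
import Mathlib.RingTheory.Localization.Integral
import Literature.NumberTheory.Automorphic.BCDTTheoremB
import Literature.NumberTheory.GaloisRepresentations.ModThreeImageOrderEightAbsIrreducible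
import Literature.NumberTheory.EllipticCurves.KleinQuinticSectionTable
import Literature.NumberTheory.EllipticCurves.GaloisActionProofs
import Literature.NumberTheory.EllipticCurves.KleinQuinticSectionTableCerts
import Literature.NumberTheory.EllipticCurves.ModFiveCongruenceHesseSyzygy
import Mathlib.Tactic.IntervalCases
import Mathlib.Tactic.LinearCombination
import Mathlib.Algebra.Polynomial.Derivative

/-! CHK5r (planner k2 g30 pre-flight, NOT a proposal): M5r = rev/CDTThreeFiveSwitchProofs.lean (revision r1) verbatim below its
imports, with its two non-tree imports (M3Vr KleinQuinticTorsionFrame, M4r CDTThreeFiveSwitchDescent) replaced by statement-verbatim mocks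
(public bottom lines only: `thm132_restricted(_holds)`, `Core1728`, `core1728_of_icosahedral_descent`, `Core1728_holds`). -/

namespace Literature.NumberTheory.EllipticCurves.KleinQuinticTorsion

open _root_.Literature.NumberTheory.EllipticCurves _root_.Literature.NumberTheory.EllipticCurves.HesseFamilyFive
open _root_.Literature.NumberTheory.Automorphic _root_.Literature.NumberTheory.Automorphic.BCDT _root_.WeierstrassCurve

def thm132_restricted : Prop :=
  ∀ (E E' : WeierstrassCurve ℚ) [E.IsElliptic] [E'.IsElliptic] (c₄ c₆ l m : ℚ), c₆ ≠ 0 →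
    E = ⟨0, 0, 0, -27 * c₄, -54 * c₆⟩ →
    E' = ⟨0, 0, 0, -27 * C4 c₄ c₆ l m, -54 * C6 c₄ c₆ l m⟩ → Congr E' E

theorem thm132_restricted_holds : thm132_restricted := by
  sorry

end Literature.NumberTheory.EllipticCurves.KleinQuinticTorsion

namespace Literature.NumberTheory.Automorphic.CDTThreeFiveSwitch.Descent

open _root_.Literature.NumberTheory.EllipticCurves _root_.Literature.NumberTheory.EllipticCurves.HesseFamilyFive
open _root_.Literature.NumberTheory.Automorphic _root_.Literature.NumberTheory.GaloisRepresentations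
open _root_.Literature.NumberTheory.Automorphic.BCDT _root_.WeierstrassCurve

def Core1728 : Prop :=
  ∀ (c₄ c₆ : ℤ), c₄ ^ 3 ≠ c₆ ^ 2 → c₆ ≠ 0 →
    ∃ (τ : Field.absoluteGaloisGroup ℚ) (t₁ : AlgebraicClosure ℚ),
      (∀ s : AlgebraicClosure ℚ, s ^ 2 = -3 → τ • s = -s) ∧
      (∀ z : AlgebraicClosure ℚ, z ^ 4 = 1 → τ • z = z) ∧
      C6 (c₄ : AlgebraicClosure ℚ) c₆ t₁ 1 = 0 ∧ C4 (c₄ : AlgebraicClosure ℚ) c₆ t₁ 1 ≠ 0 ∧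
        τ • t₁ = t₁

theorem core1728_of_icosahedral_descent : Core1728 := by
  sorry

theorem Core1728_holds : Core1728 := core1728_of_icosahedral_descent

end Literature.NumberTheory.Automorphic.CDTThreeFiveSwitch.Descent

/-!
# The `3`–`5` switch, part II: the road `Fisher (i) → Core1728 → F2 → BCDT.CDT_three_five_switch` — PROVED;
# the named fact `BCDT.CDT_three_five_switch` DISCHARGED (`CDT_three_five_switch_holds`)

Wiles' `3`–`5` switch in the form catalogued as the named fact `BCDT.CDT_three_five_switch`
(`CDTTheorem712`; Conrad–Diamond–Taylor 1999, proof of Thm. 7.1.2, p. 556; Wiles 1995 Ch. 5): for `E/ℚ`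
and `ρ̄ = ρ̄_{E,5}` absolutely irreducible on `Γ_{ℚ(√5)}` there is `E'/ℚ` with `E'[5] ≃ ρ̄` and
`ρ̄_{E',3}` absolutely irreducible on `Γ_{ℚ(√−3)}`.  The road: `W ↦ W♭ = base(c₄, c₆)` (G6); the
`5`-congruent twist-free curves are the Hesse family (Fisher 13.2 (i), `c₆ ≠ 0`:
`KleinQuinticTorsion.thm132_restricted_holds`; the `c₆ = 0` branch needs no Fisher) parametrised through
Klein's icosahedral descent (`Descent.Core1728_holds`); a member with good reduction at
a Dirichlet prime `q ≡ 2 (3)` and `3 ∤ a_q(E')` exists (G2/G3: Chebotarev in the `5`-division field at the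
twisted `1728`-fibre, `PrimesInAP`); for such `E'` a Frobenius at `q` has order `8` on `E'[3]` (F2a/F2b:
`det = −1`, `tr ≠ 0` in `GL₂(𝔽₃)`, `decide`), and ORDER `8` + `det ρ̄ = χ̄₃` ⇒ absolute irreducibility
on `Γ_{ℚ(√−3)}` — the group-theoretic criterion, which is the tree's
`ModThreeOrderEight.orderEightCriterion` (`GaloisRepresentations/ModThreeImageOrderEightAbsIrreducible`); it enters
as the explicit hypothesis `h8c` of `frobeniusCertificate_of_orderEightCriterion` (the certificate
`FrobeniusCertificate W` is stated in binder form: an intermediate of this proof, not a named fact) and of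

  `theorem CDT_three_five_switch_of_orderEightCriterion (h8c : …) : BCDT.CDT_three_five_switch`,

and the bottom line is the named fact under its own name, so that the facts probe records the discharge:

  `theorem BCDT.CDT_three_five_switch_holds : CDT_three_five_switch`.

Consumers that took `(h : CDT_three_five_switch)` (`CDTTheorem712ConductorStepProofs`, `…TwoLiftsProofs`,
`…OggThree(Two)Proofs`, `BCDTTheoremACasesProofs`, `BCDTTheoremAOfLiftThreeProofs`, `CDTTheorem724Assembly`) are fed
`CDT_three_five_switch_holds`; the registered stub `stub_switch` of the summit crux `FreyModularity`
(stmt-ABC-11340, route DefiniteXi), whose signature is `CDT_three_five_switch` unfolded, is then one line in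
`Summits/ABC/ABC/Theorems/DefiniteXiFreyModularityStubSwitch.lean`.

Provenance: second half of the crux workfile `Summits/ABC/ABC/Cruxes/FreyModularity/STUB_IDEAS_stub_switch_3g11_Road.lean`
(farm rc 0, 0 sorry) with: namespace ↦ `Literature.NumberTheory.Automorphic.CDTThreeFiveSwitch.Road`; the named fact F1 as hypothesis `hF` ↦ the PROVED
restricted form `KleinQuinticTorsion.thm132_restricted` (3 sites; its one call gets the extra argument
`c₆ ≠ 0`, available in that branch); `frobeniusCertificate` ↦ `frobeniusCertificate_of_orderEightCriterion`
(hypothesis `h8c` replaces the Summits-side lemma); `import Summits.…StubAbsIrrNegThreeGroup` dropped;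
bottom line added.  Whole chain kernel-checked as one file (k3 g14 "D": rc 0, 0 sorry, axioms standard).
Revision r1 (2026-09-01, after the review of p844579): consumes `Descent.Core1728_holds`; the criterion module
`ModThreeImageOrderEightAbsIrreducible` (in the tree since p844123) is imported and `BCDT.CDT_three_five_switch_holds`
is stated here; linter options justified; nothing else.

## References
* [ConradDiamondTaylor1999] B. Conrad, F. Diamond, R. Taylor, Modularity of certain potentially Barsotti–Tate Galois representations, JAMS 12 (1999), proof of Thm. 7.1.2 (p. 556).
* [Wiles1995] A. Wiles, Modular elliptic curves and Fermat's Last Theorem, Ann. of Math. 141 (1995), Ch. 5.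
* [BCDTJAMS2001] C. Breuil, B. Conrad, F. Diamond, R. Taylor, JAMS 14 (2001), p. 843.
* [Fisher2012Hessian] T. Fisher, Proc. LMS 104 (2012), Thm 13.2 (i).
* [Serre1972] J.-P. Serre, Invent. Math. 15 (1972) (images of `ρ̄_{E,ℓ}`).
-/

-- Linter options (CONVENTIONS §4, one-line justification each): the proofs below are the farm-certified crux-workfile bytes
-- (k3 g4–g11 road, k2 g17 placement), kept verbatim so the certificate stays valid; restyling them is out of scope here.
set_option linter.unusedVariables false   -- verbatim certificate bytes: a few helper binders are kept unused on purpose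
set_option linter.unusedSectionVars false -- the `variable` blocks of §F2/§4 are shared by lemmas that do not all use them
set_option linter.unusedSimpArgs false    -- uniform `simp only […]` unfolding lists across the certificate blocks
set_option linter.style.longLine false    -- explicit matrices / polynomial identities exceed 100 columns

open scoped MatrixGroups NumberField
open _root_.Matrix _root_.Field _root_.IsDedekindDomain _root_.NumberField
open _root_.Literature.NumberTheory.EllipticCurves _root_.Literature.NumberTheory.EllipticCurves.HesseFamilyFive
open _root_.Literature.NumberTheory.EllipticCurves.BSZLemma17
open _root_.Literature.NumberTheory.Automorphic _root_.Literature.NumberTheory.GaloisRepresentations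
open _root_.Literature.NumberTheory.Automorphic.BCDT _root_.WeierstrassCurve
open _root_.Rat.HeightOneSpectrum

-- Mathlib's `AddSubgroup.torsionBy.zmodModule` is a `def` meant to be used as a local instance (the `ZMod n`-module
-- structure on `A[n]`); the tree's torsion-Galois-representation files use it the same way.
attribute [local instance] AddSubgroup.torsionBy.zmodModule

namespace Literature.NumberTheory.Automorphic.CDTThreeFiveSwitch.Road

noncomputable section

/-! # §F2 The order-8 Frobenius certificate (PROVED) -/


/-- F2 = k1's gen-2 atom `FrobeniusCertificate` (verbatim g4). [cite: ConradDiamondTaylor1999, proof of Thm. 7.1.2 (p. 556)] -/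
private def FrobeniusCertificate (W : WeierstrassCurve ℚ) : Prop :=
  ∀ [W.IsElliptic] [W.IsGloballyMinimal] (q : ℕ) [Fact q.Prime],
    q % 3 = 2 → W.HasGoodReductionAtPrime q → ¬ (3 : ℤ) ∣ W.frobeniusTrace q →
    ∀ ρ₃ : ModPGaloisRep ℚ (ZMod 3) 2, W.IsTorsionGaloisRep 3 ρ₃ → ρ₃.IsAbsIrreducibleOverSqrt (-3)

/-! ## F2-frame: trace and determinant of `σ` on `E[ℓ]` are those of the matrix `ρ̄(σ)` -/

/-- **Frame transport.**  For a framed model `ρ̄` of `E[ℓ]` (`e (σ • P) = ρ̄(σ) · e P`) the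
`𝔽_ℓ`-linear map `P ↦ σ • P` of `E[ℓ]` is conjugate by the frame to `v ↦ ρ̄(σ) v`, so its trace and
determinant are `tr ρ̄(σ)` and `det ρ̄(σ)` (`LinearMap.trace_conj'`, `LinearMap.det_conj`). [folklore] -/
private theorem trace_det_galoisRepTorsion_eq_of_isTorsionGaloisRep {F : Type*} [Field F]
    (W : WeierstrassCurve F) (ℓ : ℕ) [Fact ℓ.Prime] {ρ : ModPGaloisRep F (ZMod ℓ) 2}
    (hρ : W.IsTorsionGaloisRep ℓ ρ) (σ : absoluteGaloisGroup F) :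
    LinearMap.trace (ZMod ℓ) (geomTorsion W ℓ)
        ((galoisRepTorsion W ℓ σ).toAdd.toAddMonoidHom.toZModLinearMap ℓ) =
      Matrix.trace ((ρ σ : GL (Fin 2) (ZMod ℓ)) : Matrix (Fin 2) (Fin 2) (ZMod ℓ)) ∧
    LinearMap.det ((galoisRepTorsion W ℓ σ).toAdd.toAddMonoidHom.toZModLinearMap ℓ) =
      Matrix.det ((ρ σ : GL (Fin 2) (ZMod ℓ)) : Matrix (Fin 2) (Fin 2) (ZMod ℓ)) := by
  classical
  obtain ⟨e, he⟩ := hρ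
  set M : Matrix (Fin 2) (Fin 2) (ZMod ℓ) :=
    ((ρ σ : GL (Fin 2) (ZMod ℓ)) : Matrix (Fin 2) (Fin 2) (ZMod ℓ)) with hM
  set f := (galoisRepTorsion W ℓ σ).toAdd.toAddMonoidHom.toZModLinearMap ℓ with hfdef
  have hf : ∀ Q : geomTorsion W ℓ, f Q = σ • Q := fun Q ↦ rfl
  -- the frame as an `𝔽_ℓ`-linear equivalence
  let eₗ : geomTorsion W ℓ ≃ₗ[ZMod ℓ] (Fin 2 → ZMod ℓ) :=
    { e.toAddMonoidHom.toZModLinearMap ℓ with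
      invFun := e.symm
      left_inv := e.left_inv
      right_inv := e.right_inv }
  have heₗ : ∀ P, eₗ P = e P := fun P ↦ rfl
  have heₗ' : ∀ v, eₗ.symm v = e.symm v := fun v ↦ rfl
  have hconj : eₗ.conj f = Matrix.toLin' M := by
    refine LinearMap.ext fun v ↦ ?_
    rw [LinearEquiv.conj_apply_apply, Matrix.toLin'_apply, heₗ, heₗ', hf, he, hM,
      AddEquiv.apply_symm_apply]
  refine ⟨?_, ?_⟩
  · rw [← LinearMap.trace_conj' f eₗ, hconj, Matrix.trace_toLin'_eq]
  · rw [← LinearMap.det_conj f eₗ, ← LinearMap.det_toLin' M, ← hconj, LinearEquiv.conj_apply,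
      LinearMap.comp_assoc]

/-! ## F2b: `det = -1`, `tr ≠ 0` in `GL₂(𝔽₃)` ⇒ order `8` -/

/-- In `M₂(𝔽₃)`: `det g = -1` and `tr g ≠ 0` force `g⁸ = 1 ≠ g⁴` (the characteristic polynomial
`X² ∓ X − 1` is irreducible over `𝔽₃`, its roots in `𝔽₉` have order `8`).  Finite check. [folklore] -/
private theorem pow_eight_of_det_eq_neg_one_of_trace_ne_zero (g : Matrix (Fin 2) (Fin 2) (ZMod 3))
    (hg : g.det = -1) (htr : g.trace ≠ 0) : g ^ 8 = 1 ∧ g ^ 4 ≠ 1 := by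
  obtain ⟨p, q, r, s, rfl⟩ : ∃ p q r s : ZMod 3, g = !![p, q; r, s] :=
    ⟨_, _, _, _, Matrix.eta_fin_two g⟩
  rw [Matrix.det_fin_two_of] at hg
  rw [Matrix.trace_fin_two_of] at htr
  revert p q r s
  decide +kernel

/-- **F2b.** An element of `GL₂(𝔽₃)` with `det = -1` and `tr ≠ 0` has order `8`. [folklore] -/
private theorem orderOf_eq_eight_of_det_eq_neg_one (g : GL (Fin 2) (ZMod 3))
    (hdet : Matrix.det (g : Matrix (Fin 2) (Fin 2) (ZMod 3)) = -1)
    (htr : Matrix.trace (g : Matrix (Fin 2) (Fin 2) (ZMod 3)) ≠ 0) : orderOf g = 8 := by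
  obtain ⟨h8, h4⟩ := pow_eight_of_det_eq_neg_one_of_trace_ne_zero _ hdet htr
  have h8' : g ^ 2 ^ (2 + 1) = 1 := by
    rw [← Units.val_eq_one, Units.val_pow_eq_pow_val]
    exact h8
  have h4' : ¬ g ^ 2 ^ 2 = 1 := by
    intro h1
    apply h4
    have h2 := congrArg (fun u : GL (Fin 2) (ZMod 3) ↦ (u : Matrix (Fin 2) (Fin 2) (ZMod 3))) h1
    simp only [Units.val_pow_eq_pow_val, Units.val_one] at h2
    exact h2
  have := orderOf_eq_prime_pow h4' h8'
  simpa using this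

/-! ## F2a: a good ordinary-mod-3 prime `q ≡ 2 (3)` gives a Frobenius of order `8` on `E[3]` -/

/-- **F2a.** `E/ℚ` globally minimal, `q ≡ 2 (mod 3)` a good prime with `3 ∤ a_q`, `ρ̄` a framed
model of `E[3]`: an arithmetic Frobenius `σ_q` has `det ρ̄(σ_q) = q̄ = -1`
(`det_galoisRepTorsion_frobenius_eq`) and `tr ρ̄(σ_q) = ā_q ≠ 0`
(`trace_galoisRepTorsion_frobenius_eq`), hence order `8`. [folklore] -/
private theorem exists_orderOf_eq_eight_of_not_dvd_frobeniusTrace (W : WeierstrassCurve ℚ) [W.IsElliptic]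
    [W.IsGloballyMinimal] (q : ℕ) [Fact q.Prime] (hq : q % 3 = 2)
    (hgood : W.HasGoodReductionAtPrime q) (ha : ¬ (3 : ℤ) ∣ W.frobeniusTrace q)
    {ρ : ModPGaloisRep ℚ (ZMod 3) 2} (hρ : W.IsTorsionGaloisRep 3 ρ) :
    ∃ σ : absoluteGaloisGroup ℚ, orderOf (ρ σ) = 8 := by
  classical
  have h2 : ((2 : ℕ) : ZMod 3) = -1 := by decide
  haveI : Fact (Nat.Prime 3) := ⟨Nat.prime_three⟩
  have hq3 : q ≠ 3 := by rintro rfl; simp at hq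
  obtain ⟨v, 𝔓, σ, hv, -, h𝔓, hσ⟩ := exists_isArithFrobAt_placeOver q
  have htr := W.trace_galoisRepTorsion_frobenius_eq 3 hq3 hgood hv h𝔓 hσ
  have hdet := W.det_galoisRepTorsion_frobenius_eq 3 hq3 hgood hv h𝔓 hσ
  obtain ⟨htr', hdet'⟩ := trace_det_galoisRepTorsion_eq_of_isTorsionGaloisRep W 3 hρ σ
  refine ⟨σ, orderOf_eq_eight_of_det_eq_neg_one (ρ σ) ?_ ?_⟩
  · rw [← hdet', hdet, ← ZMod.natCast_mod q 3, hq, h2]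
  · rw [← htr', htr]
    intro h0
    apply ha
    exact (ZMod.intCast_zmod_eq_zero_iff_dvd _ 3).mp h0

/-- **F2 modulo the order-`8` criterion**: `FrobeniusCertificate` from F2a (an element of order `8` in the
image), `det ρ̄ = χ̄₃` (`det_eq_modPCyclotomicCharacter_of_isTorsionGaloisRep_holds`) and the GROUP CRITERION
`h8c` (order `8` + `det = χ̄₃` ⇒ absolutely irreducible on `Γ_{ℚ(√-3)}`; the tree's
`ModThreeOrderEight.orderEightCriterion`, fed in `BCDT.CDT_three_five_switch_holds` at the end of this file).
[cite: ConradDiamondTaylor1999, proof of Thm. 7.1.2 (p. 556)] -/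
private theorem frobeniusCertificate_of_orderEightCriterion
    (h8c : ∀ (ρ : ModPGaloisRep ℚ (ZMod 3) 2),
      (∀ σ : Field.absoluteGaloisGroup ℚ, Matrix.GeneralLinearGroup.det (ρ σ) =
        Literature.NumberTheory.GaloisRepresentations.modPCyclotomicCharacterZMod ℚ 3 σ) →
      ∀ σ₀ : Field.absoluteGaloisGroup ℚ, orderOf (ρ σ₀) = 8 → ρ.IsAbsIrreducibleOverSqrt (-3)) :
    ∀ W, FrobeniusCertificate W := by
  intro W _ _ q _ hq hgood ha ρ₃ hρ
  have hdet := W.det_eq_modPCyclotomicCharacter_of_isTorsionGaloisRep_holds 3 ρ₃ hρ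
  obtain ⟨σ, h8⟩ := exists_orderOf_eq_eight_of_not_dvd_frobeniusTrace W q hq hgood ha hρ
  exact h8c ρ₃ hdet σ h8


/-! # §G Vocabulary, numerators, G6, G2, G3 (PROVED) -/


/-! ## §0 Vocabulary (verbatim g4 §1) -/

/-- Fisher's Hesse member `E_{l,m} : y² = x³ − 27𝔠₄(l,m)x − 54𝔠₆(l,m)` over `(c₄, c₆)`. [folklore] -/
private abbrev member (c₄ c₆ l m : ℚ) : WeierstrassCurve ℚ :=
  ⟨0, 0, 0, -27 * C4 c₄ c₆ l m, -54 * C6 c₄ c₆ l m⟩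

/-- The `c₄c₆`-model (= the member at `(l:m) = (1:0)`). [folklore] -/
private abbrev base (c₄ c₆ : ℚ) : WeierstrassCurve ℚ := ⟨0, 0, 0, -27 * c₄, -54 * c₆⟩

/-! ## §N Integer numerators of Fisher's `𝔠₄, 𝔠₆` and their homogeneity -/

section Numerators

variable {R S : Type*} [CommRing R] [CommRing S]

/-- `N4 := −(𝔇_λλ𝔇_μμ − 𝔇_λμ²)`, so that `𝔠₄ = N4 / 17424` (degree `20` in `(l,m)`). [folklore] -/
private def N4 (c₄ c₆ l m : R) : R :=
  -(Dll c₄ c₆ l m * Dmm c₄ c₆ l m - Dlm c₄ c₆ l m ^ 2)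

/-- `Pl := 𝔇_λλλ𝔇_μμ + 𝔇_λλ𝔇_λμμ − 2𝔇_λμ𝔇_λλμ` (`𝔠₄,λ = −Pl/17424`; degree `19`). [folklore] -/
private def Pl (c₄ c₆ l m : R) : R :=
  Dlll c₄ c₆ l m * Dmm c₄ c₆ l m + Dll c₄ c₆ l m * Dlmm c₄ c₆ l m
    - 2 * Dlm c₄ c₆ l m * Dllm c₄ c₆ l m

/-- `Pm := 𝔇_λλμ𝔇_μμ + 𝔇_λλ𝔇_μμμ − 2𝔇_λμ𝔇_λμμ` (`𝔠₄,μ = −Pm/17424`; degree `19`). [folklore] -/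
private def Pm (c₄ c₆ l m : R) : R :=
  Dllm c₄ c₆ l m * Dmm c₄ c₆ l m + Dll c₄ c₆ l m * Dmmm c₄ c₆ l m
    - 2 * Dlm c₄ c₆ l m * Dlmm c₄ c₆ l m

/-- `N6 := 𝔇_μ·Pl − 𝔇_λ·Pm`, so that `𝔠₆ = N6 / (17424·240)` (degree `30` in `(l,m)`). [folklore] -/
private def N6 (c₄ c₆ l m : R) : R :=
  Dm c₄ c₆ l m * Pl c₄ c₆ l m - Dl c₄ c₆ l m * Pm c₄ c₆ l m

/-- `map_N4` — step of the `3`–`5` switch road (see the module docstring). [folklore] -/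
private theorem map_N4 {F : Type*} [FunLike F R S] [RingHomClass F R S] (f : F) (c₄ c₆ l m : R) :
    f (N4 c₄ c₆ l m) = N4 (f c₄) (f c₆) (f l) (f m) := by
  simp only [N4, Dll, Dmm, Dlm, map_add, map_sub, map_mul, map_pow, map_neg, map_ofNat]

/-- `map_N6` — step of the `3`–`5` switch road (see the module docstring). [folklore] -/
private theorem map_N6 {F : Type*} [FunLike F R S] [RingHomClass F R S] (f : F) (c₄ c₆ l m : R) :
    f (N6 c₄ c₆ l m) = N6 (f c₄) (f c₆) (f l) (f m) := by
  simp only [N6, Pl, Pm, Dl, Dm, Dll, Dmm, Dlm, Dlll, Dllm, Dlmm, Dmmm, map_add, map_sub, map_mul,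
    map_pow, map_neg, map_ofNat]

/-- `intCast_N4` — step of the `3`–`5` switch road (see the module docstring). [folklore] -/
private theorem intCast_N4 (c₄ c₆ l m : ℤ) :
    ((N4 c₄ c₆ l m : ℤ) : R) = N4 (c₄ : R) (c₆ : R) (l : R) (m : R) := by
  have h := map_N4 (Int.castRingHom R) c₄ c₆ l m
  simpa only [eq_intCast] using h

/-- `intCast_N6` — step of the `3`–`5` switch road (see the module docstring). [folklore] -/
private theorem intCast_N6 (c₄ c₆ l m : ℤ) :
    ((N6 c₄ c₆ l m : ℤ) : R) = N6 (c₄ : R) (c₆ : R) (l : R) (m : R) := by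
  have h := map_N6 (Int.castRingHom R) c₄ c₆ l m
  simpa only [eq_intCast] using h

/-! ### homogeneity, derivative by derivative -/

/-- `Dl_smul` — step of the `3`–`5` switch road (see the module docstring). [folklore] -/
private theorem Dl_smul (c₄ c₆ n l m : R) : Dl c₄ c₆ (n * l) (n * m) = n ^ 11 * Dl c₄ c₆ l m := by
  simp only [Dl]; ring
/-- `Dm_smul` — step of the `3`–`5` switch road (see the module docstring). [folklore] -/
private theorem Dm_smul (c₄ c₆ n l m : R) : Dm c₄ c₆ (n * l) (n * m) = n ^ 11 * Dm c₄ c₆ l m := by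
  simp only [Dm]; ring
/-- `Dll_smul` — step of the `3`–`5` switch road (see the module docstring). [folklore] -/
private theorem Dll_smul (c₄ c₆ n l m : R) : Dll c₄ c₆ (n * l) (n * m) = n ^ 10 * Dll c₄ c₆ l m := by
  simp only [Dll]; ring
/-- `Dlm_smul` — step of the `3`–`5` switch road (see the module docstring). [folklore] -/
private theorem Dlm_smul (c₄ c₆ n l m : R) : Dlm c₄ c₆ (n * l) (n * m) = n ^ 10 * Dlm c₄ c₆ l m := by
  simp only [Dlm]; ring
/-- `Dmm_smul` — step of the `3`–`5` switch road (see the module docstring). [folklore] -/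
private theorem Dmm_smul (c₄ c₆ n l m : R) : Dmm c₄ c₆ (n * l) (n * m) = n ^ 10 * Dmm c₄ c₆ l m := by
  simp only [Dmm]; ring
/-- `Dlll_smul` — step of the `3`–`5` switch road (see the module docstring). [folklore] -/
private theorem Dlll_smul (c₄ c₆ n l m : R) : Dlll c₄ c₆ (n * l) (n * m) = n ^ 9 * Dlll c₄ c₆ l m := by
  simp only [Dlll]; ring
/-- `Dllm_smul` — step of the `3`–`5` switch road (see the module docstring). [folklore] -/
private theorem Dllm_smul (c₄ c₆ n l m : R) : Dllm c₄ c₆ (n * l) (n * m) = n ^ 9 * Dllm c₄ c₆ l m := by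
  simp only [Dllm]; ring
/-- `Dlmm_smul` — step of the `3`–`5` switch road (see the module docstring). [folklore] -/
private theorem Dlmm_smul (c₄ c₆ n l m : R) : Dlmm c₄ c₆ (n * l) (n * m) = n ^ 9 * Dlmm c₄ c₆ l m := by
  simp only [Dlmm]; ring
/-- `Dmmm_smul` — step of the `3`–`5` switch road (see the module docstring). [folklore] -/
private theorem Dmmm_smul (c₄ c₆ n l m : R) : Dmmm c₄ c₆ (n * l) (n * m) = n ^ 9 * Dmmm c₄ c₆ l m := by
  simp only [Dmmm]; ring

/-- `N4` is homogeneous of degree `20` in `(l, m)`. [folklore] -/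
private theorem N4_smul (c₄ c₆ n l m : R) : N4 c₄ c₆ (n * l) (n * m) = n ^ 20 * N4 c₄ c₆ l m := by
  simp only [N4, Dll_smul, Dlm_smul, Dmm_smul]; ring

/-- `N6` is homogeneous of degree `30` in `(l, m)`. [folklore] -/
private theorem N6_smul (c₄ c₆ n l m : R) : N6 c₄ c₆ (n * l) (n * m) = n ^ 30 * N6 c₄ c₆ l m := by
  simp only [N6, Pl, Pm, Dl_smul, Dm_smul, Dll_smul, Dlm_smul, Dmm_smul, Dlll_smul, Dllm_smul,
    Dlmm_smul, Dmmm_smul]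
  ring

/-- `N4_smul_one` — step of the `3`–`5` switch road (see the module docstring). [folklore] -/
private theorem N4_smul_one (c₄ c₆ n l : R) : N4 c₄ c₆ (n * l) n = n ^ 20 * N4 c₄ c₆ l 1 := by
  simpa only [mul_one] using N4_smul c₄ c₆ n l 1

/-- `N6_smul_one` — step of the `3`–`5` switch road (see the module docstring). [folklore] -/
private theorem N6_smul_one (c₄ c₆ n l : R) : N6 c₄ c₆ (n * l) n = n ^ 30 * N6 c₄ c₆ l 1 := by
  simpa only [mul_one] using N6_smul c₄ c₆ n l 1

/-- Congruent arguments give congruent values of `N4`. [folklore] -/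
private theorem mk_N4_congr (I : Ideal R) {c₄ c₆ x y n : R} (h : x - y ∈ I) :
    Ideal.Quotient.mk I (N4 c₄ c₆ x n) = Ideal.Quotient.mk I (N4 c₄ c₆ y n) := by
  rw [map_N4, map_N4, (Ideal.Quotient.eq (I := I)).mpr h]

/-- Congruent arguments give congruent values of `N6`. [folklore] -/
private theorem mk_N6_congr (I : Ideal R) {c₄ c₆ x y n : R} (h : x - y ∈ I) :
    Ideal.Quotient.mk I (N6 c₄ c₆ x n) = Ideal.Quotient.mk I (N6 c₄ c₆ y n) := by
  rw [map_N6, map_N6, (Ideal.Quotient.eq (I := I)).mpr h]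

end Numerators

section Field

variable {F : Type*} [Field F]

/-- `C4_eq_N4_div` — step of the `3`–`5` switch road (see the module docstring). [folklore] -/
private theorem C4_eq_N4_div (c₄ c₆ l m : F) : C4 c₄ c₆ l m = N4 c₄ c₆ l m / 17424 := rfl

/-- `C6_eq_N6_div` — step of the `3`–`5` switch road (see the module docstring). [folklore] -/
private theorem C6_eq_N6_div [CharZero F] (c₄ c₆ l m : F) :
    C6 c₄ c₆ l m = N6 c₄ c₆ l m / (17424 * 240) := by
  simp only [C6, C4l, C4m, N6, Pl, Pm]
  field_simp
  ring

/-- the same identity over any field in which `17424·240` is invertible (e.g. `𝔽_ℓ`, `ℓ ∤ 66·60`). [folklore] -/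
private theorem C6_eq_N6_div' (c₄ c₆ l m : F) (h1 : (17424 : F) ≠ 0) (h2 : (240 : F) ≠ 0) :
    C6 c₄ c₆ l m = N6 c₄ c₆ l m / (17424 * 240) := by
  simp only [C6, C4l, C4m, N6, Pl, Pm]
  field_simp
  ring

/-- a prime `p ≠ ℓ` is nonzero in `𝔽_ℓ`. [folklore] -/
private theorem natCast_ne_zero_of_prime_ne {ℓ : ℕ} [Fact ℓ.Prime] {p : ℕ} (hp : p.Prime) (hne : ℓ ≠ p) :
    (p : ZMod ℓ) ≠ 0 := by
  rw [Ne, ZMod.natCast_eq_zero_iff]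
  intro h
  exact hne ((Nat.prime_dvd_prime_iff_eq (Fact.out : ℓ.Prime) hp).mp h)

end Field

/-! ## §G6 The integral `c₄c₆`-model (XS; = k1-g11 `integralModel`, AEC III.1) — PROVED -/

/-- G6a (verbatim g4 signature). [folklore] -/
private theorem exists_integral_scaling (x y : ℚ) :
    ∃ (u : ℤ) (c₄ c₆ : ℤ), u ≠ 0 ∧ (c₄ : ℚ) = (u : ℚ) ^ 4 * x ∧ (c₆ : ℚ) = (u : ℚ) ^ 6 * y := by
  refine ⟨((x.den * y.den : ℕ) : ℤ), x.num * x.den ^ 3 * y.den ^ 4, y.num * y.den ^ 5 * x.den ^ 6,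
    ?_, ?_, ?_⟩
  · exact_mod_cast (Nat.mul_pos x.den_pos y.den_pos).ne'
  · have h : (((x.den * y.den : ℕ) : ℤ) : ℚ) ^ 4 * x =
        (x.den : ℚ) ^ 3 * (y.den : ℚ) ^ 4 * (x * x.den) := by
      push_cast; ring
    rw [h, Rat.mul_den_eq_num]; push_cast; ring
  · have h : (((x.den * y.den : ℕ) : ℤ) : ℚ) ^ 6 * y =
        (y.den : ℚ) ^ 5 * (x.den : ℚ) ^ 6 * (y * y.den) := by
      push_cast; ring
    rw [h, Rat.mul_den_eq_num]; push_cast; ring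

/-- G6b (verbatim g4 signature): `fisherChange_smul` + `scale_smul_short`. [folklore] -/
private theorem base_scaled (W : WeierstrassCurve ℚ) [W.IsElliptic] {u c₄ c₆ : ℤ} (hu : u ≠ 0)
    (h4 : (c₄ : ℚ) = (u : ℚ) ^ 4 * W.c₄) (h6 : (c₆ : ℚ) = (u : ℚ) ^ 6 * W.c₆) :
    ∃ Cv : VariableChange ℚ, Cv • W = base c₄ c₆ := by
  have hu0 : (u : ℚ) ≠ 0 := by exact_mod_cast hu
  refine ⟨⟨Units.mk0 (u : ℚ)⁻¹ (inv_ne_zero hu0), 0, 0, 0⟩ * fisherChange W, ?_⟩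
  rw [mul_smul, fisherChange_smul, scale_smul_short (u : ℚ) hu0]
  ext <;> simp [h4, h6] <;> ring

/-! ## §G2 The member's integral short model, reduction read off `𝔠₄, 𝔠₆ (mod ℓ)` (S) — PROVED -/

/-- **G2 (verbatim g4 signature).** `v := 17424·240`: `⟨v⁻¹,0,0,0⟩ • E_{t,1} = E_{A,B}` with
`A = −27·17424³·240⁴·N4(t,1)`, `B = −54·17424⁵·240⁵·N6(t,1)`; for `ℓ ∉ {2,3,5,11}` the constants
are `ℓ`-units. [folklore] -/
private theorem member_integral_short_mod (ℓ : ℕ) [Fact ℓ.Prime] (hℓ : ℓ ∉ ({2, 3, 5, 11} : Finset ℕ))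
    (c₄ c₆ t : ℤ) :
    ∃ (A B : ℤ) (Cv : VariableChange ℚ),
      Cv • member c₄ c₆ t 1 = shortWeierstrass (A, B) ∧
      ((A : ZMod ℓ) = 0 ↔ C4 (c₄ : ZMod ℓ) (c₆ : ZMod ℓ) (t : ZMod ℓ) 1 = 0) ∧
      ((B : ZMod ℓ) = 0 ↔ C6 (c₄ : ZMod ℓ) (c₆ : ZMod ℓ) (t : ZMod ℓ) 1 = 0) := by
  have hℓ2 : ℓ ≠ 2 := fun h => hℓ (by simp [h])
  have hℓ3 : ℓ ≠ 3 := fun h => hℓ (by simp [h])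
  have hℓ5 : ℓ ≠ 5 := fun h => hℓ (by simp [h])
  have hℓ11 : ℓ ≠ 11 := fun h => hℓ (by simp [h])
  have h2 : (2 : ZMod ℓ) ≠ 0 := by exact_mod_cast natCast_ne_zero_of_prime_ne Nat.prime_two hℓ2
  have h3 : (3 : ZMod ℓ) ≠ 0 := by exact_mod_cast natCast_ne_zero_of_prime_ne Nat.prime_three hℓ3
  have h5 : (5 : ZMod ℓ) ≠ 0 := by exact_mod_cast natCast_ne_zero_of_prime_ne Nat.prime_five hℓ5
  have h11 : (11 : ZMod ℓ) ≠ 0 := by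
    exact_mod_cast natCast_ne_zero_of_prime_ne (by norm_num) hℓ11
  have h17424 : (17424 : ZMod ℓ) ≠ 0 := by
    rw [show (17424 : ZMod ℓ) = 2 ^ 4 * 3 ^ 2 * 11 ^ 2 by norm_num]
    exact mul_ne_zero (mul_ne_zero (pow_ne_zero _ h2) (pow_ne_zero _ h3)) (pow_ne_zero _ h11)
  have h240 : (240 : ZMod ℓ) ≠ 0 := by
    rw [show (240 : ZMod ℓ) = 2 ^ 4 * 3 * 5 by norm_num]
    exact mul_ne_zero (mul_ne_zero (pow_ne_zero _ h2) h3) h5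
  have h27 : (27 : ZMod ℓ) ≠ 0 := by
    rw [show (27 : ZMod ℓ) = 3 ^ 3 by norm_num]; exact pow_ne_zero _ h3
  have h54 : (54 : ZMod ℓ) ≠ 0 := by
    rw [show (54 : ZMod ℓ) = 2 * 3 ^ 3 by norm_num]; exact mul_ne_zero h2 (pow_ne_zero _ h3)
  have hv : (17424 * 240 : ℚ) ≠ 0 := by norm_num
  refine ⟨-27 * (17424 ^ 3 * 240 ^ 4) * N4 c₄ c₆ t 1, -54 * (17424 ^ 5 * 240 ^ 5) * N6 c₄ c₆ t 1,
    ⟨Units.mk0 (17424 * 240 : ℚ)⁻¹ (inv_ne_zero hv), 0, 0, 0⟩, ?_, ?_, ?_⟩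
  · rw [show member (c₄ : ℚ) c₆ t 1 =
        ⟨0, 0, 0, -27 * C4 (c₄ : ℚ) c₆ t 1, -54 * C6 (c₄ : ℚ) c₆ t 1⟩ from rfl,
      scale_smul_short _ hv]
    ext <;> simp only [shortWeierstrass] <;> push_cast <;>
      simp only [C4_eq_N4_div, C6_eq_N6_div, intCast_N4, intCast_N6, Int.cast_one] <;>
      field_simp <;> ring
  · have hK : (-27 * (17424 ^ 3 * 240 ^ 4) : ZMod ℓ) ≠ 0 :=
      mul_ne_zero (neg_ne_zero.mpr h27) (mul_ne_zero (pow_ne_zero _ h17424) (pow_ne_zero _ h240))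
    have hcast : (((-27 * (17424 ^ 3 * 240 ^ 4) * N4 c₄ c₆ t 1 : ℤ)) : ZMod ℓ) =
        (-27 * (17424 ^ 3 * 240 ^ 4) : ZMod ℓ) * N4 (c₄ : ZMod ℓ) (c₆ : ZMod ℓ) (t : ZMod ℓ) 1 := by
      push_cast; rw [intCast_N4, Int.cast_one]; norm_num
    rw [hcast, C4_eq_N4_div, mul_eq_zero, div_eq_zero_iff]
    constructor
    · rintro (h | h)
      · exact absurd h hK
      · exact Or.inl h
    · rintro (h | h)
      · exact Or.inr h
      · exact absurd h h17424
  · have hK : (-54 * (17424 ^ 5 * 240 ^ 5) : ZMod ℓ) ≠ 0 :=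
      mul_ne_zero (neg_ne_zero.mpr h54) (mul_ne_zero (pow_ne_zero _ h17424) (pow_ne_zero _ h240))
    have hcast : (((-54 * (17424 ^ 5 * 240 ^ 5) * N6 c₄ c₆ t 1 : ℤ)) : ZMod ℓ) =
        (-54 * (17424 ^ 5 * 240 ^ 5) : ZMod ℓ) * N6 (c₄ : ZMod ℓ) (c₆ : ZMod ℓ) (t : ZMod ℓ) 1 := by
      push_cast; rw [intCast_N6, Int.cast_one]; norm_num
    have h1 : (17424 * 240 : ZMod ℓ) ≠ 0 := mul_ne_zero h17424 h240
    rw [hcast, C6_eq_N6_div' _ _ _ _ h17424 h240, mul_eq_zero, div_eq_zero_iff]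
    constructor
    · rintro (h | h)
      · exact absurd h hK
      · exact Or.inl h
    · rintro (h | h)
      · exact Or.inr h
      · exact absurd h h1


/-! ## §G3 Chebotarev at the twisted `1728`-fibre (M) — atoms -/

section G3

/-- **G3a (Chebotarev in a coset, for `ℚ(x, y)`).**  Outside any finite set of places there is a
place `v` with a prime `𝔓 ∣ v` of `\bar ℤ` and an arithmetic Frobenius `φ` at `𝔓` such that `φg⁻¹`
fixes `ℚ(x, y)` pointwise.  (`N := Gal(\bar ℚ/E)`, `E` the normal closure of `ℚ(x,y)`: open
(`fixingSubgroup_isOpen`), normal (`InfiniteGalois.normal_iff_isGalois`); tree PROVED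
`exists_isArithFrobAt_mul_inv_mem_not_mem`.) [Neukirch ANT VII.13.4] [folklore] -/
private theorem exists_frob_fixing_adjoin (x y : AlgebraicClosure ℚ) (g : absoluteGaloisGroup ℚ)
    (S : Set (HeightOneSpectrum (𝓞 ℚ))) (hS : S.Finite) :
    ∃ v ∉ S, ∃ 𝔓 ∈ v.primesAbove, ∃ φ : absoluteGaloisGroup ℚ, IsArithFrobAt (𝓞 ℚ) φ 𝔓 ∧
      ∀ z ∈ IntermediateField.adjoin ℚ ({x, y} : Set (AlgebraicClosure ℚ)), (φ * g⁻¹) • z = z := by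
  classical
  set K : IntermediateField ℚ (AlgebraicClosure ℚ) :=
    IntermediateField.adjoin ℚ ({x, y} : Set (AlgebraicClosure ℚ)) with hK
  haveI : Algebra.IsAlgebraic ℚ (AlgebraicClosure ℚ) := AlgebraicClosure.isAlgebraic ℚ
  haveI : IsAlgClosure ℚ (AlgebraicClosure ℚ) := ⟨inferInstance, inferInstance⟩
  haveI : Normal ℚ (AlgebraicClosure ℚ) := inferInstance
  haveI : IsGalois ℚ (AlgebraicClosure ℚ) := IsGalois.mk
  haveI : FiniteDimensional ℚ K :=
    IntermediateField.finiteDimensional_adjoin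
      (fun z _ => (Algebra.IsAlgebraic.isAlgebraic (R := ℚ) z).isIntegral)
  set E : IntermediateField ℚ (AlgebraicClosure ℚ) :=
    IntermediateField.normalClosure ℚ K (AlgebraicClosure ℚ) with hE
  haveI : FiniteDimensional ℚ E := normalClosure.is_finiteDimensional ℚ K (AlgebraicClosure ℚ)
  haveI hEG : IsGalois ℚ E := IsGalois.normalClosure ℚ K (AlgebraicClosure ℚ)
  set N : Subgroup (absoluteGaloisGroup ℚ) := E.fixingSubgroup with hN
  haveI : N.Normal := (InfiniteGalois.normal_iff_isGalois E).mpr hEG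
  have hNopen : IsOpen (N : Set (absoluteGaloisGroup ℚ)) := IntermediateField.fixingSubgroup_isOpen E
  obtain ⟨v, hvS, -, 𝔓, h𝔓, φ, hφ, hmem⟩ :=
    exists_isArithFrobAt_mul_inv_mem_not_mem ℚ N hNopen g S hS
  refine ⟨v, hvS, 𝔓, h𝔓, φ, hφ, fun z hz => ?_⟩
  have hKE : K ≤ E := IntermediateField.le_normalClosure K
  exact (mem_fixingSubgroup_iff_forall_smul E (φ * g⁻¹)).mp hmem ⟨z, hKE hz⟩

/-- `𝔓 ∩ ℤ = p_v ℤ` for `𝔓 ∣ v`. [folklore] -/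
private theorem intCast_mem_iff_dvd {v : HeightOneSpectrum (𝓞 ℚ)} {𝔓 : Ideal (absIntegers (𝓞 ℚ) ℚ)}
    (h𝔓 : 𝔓 ∈ v.primesAbove) (n : ℤ) :
    (n : absIntegers (𝓞 ℚ) ℚ) ∈ 𝔓 ↔ (natGenerator v : ℤ) ∣ n := by
  haveI : 𝔓.LiesOver v.asIdeal := (HeightOneSpectrum.mem_primesAbove_iff.mp h𝔓).2
  rw [← Rat.intCast_mem_asIdeal_iff, Ideal.mem_of_liesOver 𝔓 v.asIdeal, map_intCast]

/-- a rational prime that dies in `\bar ℤ/𝔓` is the prime under `𝔓`. [folklore] -/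
private theorem natGenerator_eq_of_natCast_quot_eq_zero {v : HeightOneSpectrum (𝓞 ℚ)}
    {𝔓 : Ideal (absIntegers (𝓞 ℚ) ℚ)} (h𝔓 : 𝔓 ∈ v.primesAbove) {p : ℕ} (hp : p.Prime)
    (h : (p : absIntegers (𝓞 ℚ) ℚ ⧸ 𝔓) = 0) : natGenerator v = p := by
  rw [← map_natCast (Ideal.Quotient.mk 𝔓), Ideal.Quotient.eq_zero_iff_mem] at h
  have h' : ((p : ℤ) : absIntegers (𝓞 ℚ) ℚ) ∈ 𝔓 := by rwa [Int.cast_natCast]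
  rw [intCast_mem_iff_dvd h𝔓, Int.natCast_dvd_natCast] at h'
  exact (Nat.prime_dvd_prime_iff_eq (prime_natGenerator v) hp).mp h'

/-- **B5 (PROVED by k1-g11, copied verbatim): a Frobenius-fixed algebraic integer is congruent to a
rational integer mod `𝔓`.** [folklore] -/
private theorem helper_exists_int_congr_of_frob_fixed {v : HeightOneSpectrum (𝓞 ℚ)}
    {𝔓 : Ideal (absIntegers (𝓞 ℚ) ℚ)} (h𝔓 : 𝔓 ∈ v.primesAbove)
    {φ : absoluteGaloisGroup ℚ} (hφ : IsArithFrobAt (𝓞 ℚ) φ 𝔓)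
    (A : absIntegers (𝓞 ℚ) ℚ) (hA : φ • A = A) : ∃ a : ℤ, A - a ∈ 𝔓 := by
  haveI h𝔓max : 𝔓.IsMaximal := HeightOneSpectrum.isMaximal_of_mem_primesAbove h𝔓
  haveI : 𝔓.LiesOver v.asIdeal := (HeightOneSpectrum.mem_primesAbove_iff.mp h𝔓).2
  have hover : v.asIdeal = 𝔓.under (𝓞 ℚ) := Ideal.LiesOver.over
  -- the Frobenius congruence for the fixed element `A`
  have h1 : φ • A - A ^ Nat.card (𝓞 ℚ ⧸ 𝔓.under (𝓞 ℚ)) ∈ 𝔓 := hφ A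
  rw [hA, ← hover] at h1
  -- residue fields
  letI : Field (absIntegers (𝓞 ℚ) ℚ ⧸ 𝔓) := Ideal.Quotient.field 𝔓
  haveI : v.asIdeal.IsMaximal := v.isMaximal
  letI : Field (𝓞 ℚ ⧸ v.asIdeal) := Ideal.Quotient.field v.asIdeal
  haveI : Finite (𝓞 ℚ ⧸ v.asIdeal) := by rw [hover]; exact hφ.finite_quotient
  let ι : 𝓞 ℚ ⧸ v.asIdeal →+* absIntegers (𝓞 ℚ) ℚ ⧸ 𝔓 :=
    Ideal.quotientMap 𝔓 (algebraMap (𝓞 ℚ) (absIntegers (𝓞 ℚ) ℚ)) hover.le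
  have h2 : (Ideal.Quotient.mk 𝔓 A) ^ Nat.card (𝓞 ℚ ⧸ v.asIdeal) = Ideal.Quotient.mk 𝔓 A := by
    rw [← map_pow, eq_comm, Ideal.Quotient.eq]; exact h1
  obtain ⟨w, hw⟩ := Literature.AlgebraicGeometry.Motives.mem_range_of_pow_card_eq ι h2
  obtain ⟨r, rfl⟩ := Ideal.Quotient.mk_surjective w
  have hw' : Ideal.Quotient.mk 𝔓 (algebraMap (𝓞 ℚ) (absIntegers (𝓞 ℚ) ℚ) r) =
      Ideal.Quotient.mk 𝔓 A := by
    rw [← hw]; exact (Ideal.quotientMap_mk).symm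
  -- `r ∈ 𝓞 ℚ` is a rational integer
  obtain ⟨a, ha⟩ : ∃ a : ℤ, (a : 𝓞 ℚ) = r :=
    ⟨Rat.ringOfIntegersEquiv r, Rat.ringOfIntegersEquiv.injective (by rw [map_intCast, Int.cast_id])⟩
  subst ha
  rw [map_intCast] at hw'
  exact ⟨a, Ideal.Quotient.eq.mp hw'.symm⟩

/-- `ζ₁₂⁶ = −1` and `ζ₁₂⁸ + ζ₁₂⁴ + 1 = 0` for a primitive `12`-th root of unity in a field. [folklore] -/
private theorem zeta12_relations {L : Type*} [Field L] {ζ : L} (hζ : IsPrimitiveRoot ζ 12) :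
    ζ ^ 12 = 1 ∧ ζ ^ 6 = -1 ∧ ζ ^ 8 + ζ ^ 4 + 1 = 0 := by
  have h12 : ζ ^ 12 = 1 := hζ.pow_eq_one
  refine ⟨h12, ?_, ?_⟩
  · have h1 : (ζ ^ 6 - 1) * (ζ ^ 6 + 1) = 0 := by linear_combination h12
    have h2 : ζ ^ 6 ≠ 1 := fun h => by
      have := (hζ.pow_eq_one_iff_dvd 6).mp h
      omega
    rcases mul_eq_zero.mp h1 with h | h
    · exact absurd (sub_eq_zero.mp h) h2
    · linear_combination h
  · have hω1 : ζ ^ 4 ≠ 1 := fun h => by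
      have := (hζ.pow_eq_one_iff_dvd 4).mp h
      omega
    have h0 : (ζ ^ 4 - 1) * (ζ ^ 8 + ζ ^ 4 + 1) = 0 := by linear_combination h12
    exact (mul_eq_zero.mp h0).resolve_left (sub_ne_zero.mpr hω1)

/-- **G3b: a Frobenius acting on `μ₁₂` by `5` lies over `ℓ ≡ 5 (mod 12)`** (`ℓ ≠ 2, 3`):
`ζ⁵ = φζ ≡ ζ^ℓ (mod 𝔓)`, and the `12`-th roots of unity stay distinct mod `𝔓 ∤ 6`
(`ζ⁶ ≡ −1`, `ζ⁸ + ζ⁴ + 1 ≡ 0` force `2 ∈ 𝔓` or `3 ∈ 𝔓` otherwise). [folklore] -/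
private theorem mod_twelve_eq_five {ℓ : ℕ} [Fact ℓ.Prime] (hℓ2 : ℓ ≠ 2) (hℓ3 : ℓ ≠ 3)
    {v : HeightOneSpectrum (𝓞 ℚ)} (hv : (primesEquiv v : ℕ) = ℓ)
    {𝔓 : Ideal (absIntegers (𝓞 ℚ) ℚ)} (h𝔓 : 𝔓 ∈ v.primesAbove)
    {φ : absoluteGaloisGroup ℚ} (hφ : IsArithFrobAt (𝓞 ℚ) φ 𝔓)
    {ζ : AlgebraicClosure ℚ} (hζ : IsPrimitiveRoot ζ 12) (hφζ : φ • ζ = ζ ^ 5) : ℓ % 12 = 5 := by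
  classical
  have hℓ : ℓ.Prime := Fact.out
  have hgen : natGenerator v = ℓ := hv
  obtain ⟨hζ12, hζ6, hζ8⟩ := zeta12_relations hζ
  -- `ζ ∈ \bar ℤ`
  have hζint : ζ ∈ absIntegers (𝓞 ℚ) ℚ := by
    rw [mem_integralClosure_iff]
    exact (hζ.isIntegral (by norm_num)).tower_top
  set Z : absIntegers (𝓞 ℚ) ℚ := ⟨ζ, hζint⟩ with hZ
  have hφZ : φ • Z = Z ^ 5 := Subtype.ext (by
    rw [integralClosure.coe_smul, SubmonoidClass.coe_pow]; exact hφζ)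
  have hZ12 : Z ^ 12 = 1 := Subtype.ext (by
    rw [SubmonoidClass.coe_pow, OneMemClass.coe_one]; exact hζ12)
  have hZ6 : Z ^ 6 = -1 := Subtype.ext (by
    rw [SubmonoidClass.coe_pow, NegMemClass.coe_neg, OneMemClass.coe_one]; exact hζ6)
  have hZ8 : Z ^ 8 + Z ^ 4 + 1 = 0 := Subtype.ext (by
    rw [AddMemClass.coe_add, AddMemClass.coe_add, SubmonoidClass.coe_pow, SubmonoidClass.coe_pow,
      OneMemClass.coe_one, ZeroMemClass.coe_zero]; exact hζ8)
  -- Frobenius: `φ Z ≡ Z^ℓ (mod 𝔓)`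
  have hfrob : Z ^ 5 - Z ^ ℓ ∈ 𝔓 := by
    have h := smul_sub_pow_mem_of_isArithFrobAt hv h𝔓 hφ Z
    rwa [hφZ] at h
  -- in the residue field
  haveI : 𝔓.IsMaximal := HeightOneSpectrum.isMaximal_of_mem_primesAbove h𝔓
  letI : Field (absIntegers (𝓞 ℚ) ℚ ⧸ 𝔓) := Ideal.Quotient.field 𝔓
  set π := Ideal.Quotient.mk 𝔓 with hπ
  set z := π Z with hz
  have hz5 : z ^ 5 = z ^ ℓ := by
    rw [← sub_eq_zero, hz, ← map_pow, ← map_pow, ← map_sub, Ideal.Quotient.eq_zero_iff_mem]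
    exact hfrob
  have hz12 : z ^ 12 = 1 := by rw [hz, ← map_pow, hZ12, map_one]
  have hz6 : z ^ 6 = -1 := by rw [hz, ← map_pow, hZ6, map_neg, map_one]
  have hz8 : z ^ 8 + z ^ 4 + 1 = 0 := by
    have h := congrArg π hZ8
    rwa [map_add, map_add, map_pow, map_pow, map_one, map_zero] at h
  have hz0 : z ≠ 0 := fun h0 => by
    rw [h0, zero_pow (by norm_num)] at hz12; exact zero_ne_one hz12
  have hpow : z ^ ℓ = z ^ (ℓ % 12) := by
    conv_lhs => rw [← Nat.mod_add_div ℓ 12]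
    rw [pow_add, pow_mul, hz12, one_pow, mul_one]
  rw [hpow] at hz5
  -- `ℓ % 12 ∈ {1, 5, 7, 11}`
  have hr : ℓ % 12 = 1 ∨ ℓ % 12 = 5 ∨ ℓ % 12 = 7 ∨ ℓ % 12 = 11 := by
    have h2 : ¬ 2 ∣ ℓ := fun h => hℓ2 ((Nat.prime_dvd_prime_iff_eq Nat.prime_two hℓ).mp h).symm
    have h3 : ¬ 3 ∣ ℓ := fun h => hℓ3 ((Nat.prime_dvd_prime_iff_eq Nat.prime_three hℓ).mp h).symm
    omega
  -- the three impossible residues put `3` or `2` into `𝔓`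
  have two_ne : (2 : absIntegers (𝓞 ℚ) ℚ ⧸ 𝔓) ≠ 0 := fun h =>
    hℓ2 (hgen.symm.trans (natGenerator_eq_of_natCast_quot_eq_zero h𝔓 Nat.prime_two
      (by exact_mod_cast h)))
  have three_ne : (3 : absIntegers (𝓞 ℚ) ℚ ⧸ 𝔓) ≠ 0 := fun h =>
    hℓ3 (hgen.symm.trans (natGenerator_eq_of_natCast_quot_eq_zero h𝔓 Nat.prime_three
      (by exact_mod_cast h)))
  rcases hr with h | h | h | h
  · exfalso
    rw [h, pow_one] at hz5
    have h4 : z ^ 4 = 1 := by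
      have : z * z ^ 4 = z * 1 := by rw [mul_one, ← pow_succ']; exact hz5
      exact mul_left_cancel₀ hz0 this
    have h8 : z ^ 8 = 1 := by rw [show z ^ 8 = (z ^ 4) ^ 2 by ring, h4, one_pow]
    rw [h8, h4] at hz8
    exact three_ne (by linear_combination hz8)
  · exact h
  · exfalso
    rw [h] at hz5
    have h2 : z ^ 2 = 1 := by
      have : z ^ 5 * z ^ 2 = z ^ 5 * 1 := by rw [mul_one, ← pow_add]; exact hz5.symm
      exact mul_left_cancel₀ (pow_ne_zero _ hz0) this
    have h6 : z ^ 6 = 1 := by rw [show z ^ 6 = (z ^ 2) ^ 3 by ring, h2, one_pow]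
    exact two_ne (by linear_combination hz6 - h6)
  · exfalso
    rw [h] at hz5
    have h6 : z ^ 6 = 1 := by
      have : z ^ 5 * z ^ 6 = z ^ 5 * 1 := by rw [mul_one, ← pow_add]; exact hz5.symm
      exact mul_left_cancel₀ (pow_ne_zero _ hz0) this
    exact two_ne (by linear_combination hz6 - h6)

/-- **G3 (verbatim g4 signature) — the Chebotarev prime.**  `β := n·t₁ ∈ \bar ℤ` (`n ∈ ℤ∖0`,
`exists_integral_multiple`); `x := N4(β, n) = n²⁰N4(t₁,1) ≠ 0`, `d := d·x⁻¹ ∈ \bar ℤ`-multiple;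
Chebotarev (G3a) in the coset `σ·Gal(\bar ℚ/E)` outside `S ∪ {2,3,5,11} ∪ primes(n) ∪ primes(d)`
gives `ℓ`, `𝔓`, `φ` with `φt₁ = t₁`, `φζ = ζ⁵`; G3b gives `ℓ ≡ 5 (12)`; B5 gives `b ∈ ℤ` with
`β ≡ b (mod 𝔓)`; `N6(β,n) = n³⁰N6(t₁,1) = 0` and `N6(b,n) ≡ N6(β,n)` put `ℓ ∣ N6(b,n)`, while
`ℓ ∣ N4(b,n)` would put `x`, hence `d = x·(d x⁻¹)`, into `𝔓`; finally `t :≡ b·n⁻¹ (mod ℓ)` and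
homogeneity descend to `𝔠₆(t,1) = 0 ≠ 𝔠₄(t,1)` in `𝔽_ℓ`. [folklore] -/
private theorem exists_prime_five_mod_twelve_root (c₄ c₆ : ℤ) (hc : c₄ ^ 3 ≠ c₆ ^ 2)
    (t₁ ζ : AlgebraicClosure ℚ) (h6 : C6 (c₄ : AlgebraicClosure ℚ) c₆ t₁ 1 = 0)
    (h4 : C4 (c₄ : AlgebraicClosure ℚ) c₆ t₁ 1 ≠ 0) (hζ : IsPrimitiveRoot ζ 12)
    (σ : Field.absoluteGaloisGroup ℚ) (hσt : σ • t₁ = t₁) (hσζ : σ • ζ = ζ ^ 5) (S : Finset ℕ) :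
    ∃ (ℓ : ℕ) (_ : Fact ℓ.Prime), ℓ ∉ S ∧ ℓ % 12 = 5 ∧
      ∃ t : ℤ, C6 (c₄ : ZMod ℓ) (c₆ : ZMod ℓ) (t : ZMod ℓ) 1 = 0 ∧
        C4 (c₄ : ZMod ℓ) (c₆ : ZMod ℓ) (t : ZMod ℓ) 1 ≠ 0 := by
  classical
  haveI : Algebra.IsAlgebraic ℚ (AlgebraicClosure ℚ) := AlgebraicClosure.isAlgebraic ℚ
  -- Step 1: an integral multiple `β = n t₁`
  have ht₁alg : IsAlgebraic ℤ t₁ :=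
    (IsFractionRing.isAlgebraic_iff ℤ ℚ (AlgebraicClosure ℚ)).mpr (Algebra.IsAlgebraic.isAlgebraic t₁)
  obtain ⟨n, hn0, hnint⟩ := ht₁alg.exists_integral_multiple
  set β : AlgebraicClosure ℚ := (n : AlgebraicClosure ℚ) * t₁ with hβ
  have hβint : β ∈ absIntegers (𝓞 ℚ) ℚ := by
    rw [mem_integralClosure_iff]
    have h : IsIntegral ℤ β := by rw [hβ, ← zsmul_eq_mul]; exact hnint
    exact h.tower_top
  have hnL : (n : AlgebraicClosure ℚ) ≠ 0 := by exact_mod_cast hn0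
  -- Step 2: `N6(β, n) = 0`, `x := N4(β, n) ≠ 0`
  have hN6t : N6 (c₄ : AlgebraicClosure ℚ) c₆ t₁ 1 = 0 := by
    rw [C6_eq_N6_div, div_eq_zero_iff] at h6
    exact h6.resolve_right (by norm_num)
  have hN4t : N4 (c₄ : AlgebraicClosure ℚ) c₆ t₁ 1 ≠ 0 := by
    intro h0; apply h4; rw [C4_eq_N4_div, h0, zero_div]
  have hN6β : N6 (c₄ : AlgebraicClosure ℚ) c₆ β n = 0 := by
    rw [hβ, N6_smul_one, hN6t, mul_zero]
  set x : AlgebraicClosure ℚ := N4 (c₄ : AlgebraicClosure ℚ) c₆ β n with hx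
  have hx0 : x ≠ 0 := by
    rw [hx, hβ, N4_smul_one]; exact mul_ne_zero (pow_ne_zero _ hnL) hN4t
  -- Step 3: `d ∈ ℤ∖0` with `d x⁻¹ ∈ \bar ℤ`
  have hxalg : IsAlgebraic ℤ x⁻¹ :=
    (IsFractionRing.isAlgebraic_iff ℤ ℚ (AlgebraicClosure ℚ)).mpr (Algebra.IsAlgebraic.isAlgebraic _)
  obtain ⟨d, hd0, hdint⟩ := hxalg.exists_integral_multiple
  have hyint : (d : AlgebraicClosure ℚ) * x⁻¹ ∈ absIntegers (𝓞 ℚ) ℚ := by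
    rw [mem_integralClosure_iff]
    have h : IsIntegral ℤ ((d : AlgebraicClosure ℚ) * x⁻¹) := by rw [← zsmul_eq_mul]; exact hdint
    exact h.tower_top
  -- Step 4: the excluded primes, and Chebotarev
  set S₀ : Finset ℕ := ((S ∪ {2, 3, 5, 11}) ∪ n.natAbs.primeFactors) ∪ d.natAbs.primeFactors with hS₀
  have hSfin : {v : HeightOneSpectrum (𝓞 ℚ) | natGenerator v ∈ S₀}.Finite := by
    refine Set.Finite.preimage (f := fun v : HeightOneSpectrum (𝓞 ℚ) => natGenerator v)
      (Set.injOn_of_injective ?_) S₀.finite_toSet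
    intro v w h
    exact primesEquiv.injective (Subtype.ext h)
  obtain ⟨v, hvS, 𝔓, h𝔓, φ, hφ, hfix⟩ := exists_frob_fixing_adjoin t₁ ζ σ _ hSfin
  set ℓ : ℕ := natGenerator v with hℓdef
  haveI hℓ : Fact ℓ.Prime := ⟨prime_natGenerator v⟩
  have hv : (primesEquiv v : ℕ) = ℓ := rfl
  have hℓS₀ : ℓ ∉ S₀ := hvS
  have hmemS₀ : ∀ p, (p ∈ S ∨ p ∈ ({2, 3, 5, 11} : Finset ℕ)) ∨ p ∈ n.natAbs.primeFactors ∨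
      p ∈ d.natAbs.primeFactors → p ∈ S₀ := by
    rintro p (hp | hp | hp)
    · exact Finset.mem_union_left _ (Finset.mem_union_left _ (Finset.mem_union.mpr hp))
    · exact Finset.mem_union_left _ (Finset.mem_union_right _ hp)
    · exact Finset.mem_union_right _ hp
  have hℓS : ℓ ∉ S := fun h => hℓS₀ (hmemS₀ ℓ (Or.inl (Or.inl h)))
  have hℓ2 : ℓ ≠ 2 := fun h => hℓS₀ (hmemS₀ ℓ (Or.inl (Or.inr (by simp [h]))))
  have hℓ3 : ℓ ≠ 3 := fun h => hℓS₀ (hmemS₀ ℓ (Or.inl (Or.inr (by simp [h]))))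
  have hℓ5 : ℓ ≠ 5 := fun h => hℓS₀ (hmemS₀ ℓ (Or.inl (Or.inr (by simp [h]))))
  have hℓ11 : ℓ ≠ 11 := fun h => hℓS₀ (hmemS₀ ℓ (Or.inl (Or.inr (by simp [h]))))
  have hℓn : ¬ (ℓ : ℤ) ∣ n := fun h => hℓS₀ (hmemS₀ ℓ (Or.inr (Or.inl
    (Nat.mem_primeFactors.mpr ⟨hℓ.out, Int.natCast_dvd.mp h, Int.natAbs_ne_zero.mpr hn0⟩))))
  have hℓd : ¬ (ℓ : ℤ) ∣ d := fun h => hℓS₀ (hmemS₀ ℓ (Or.inr (Or.inr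
    (Nat.mem_primeFactors.mpr ⟨hℓ.out, Int.natCast_dvd.mp h, Int.natAbs_ne_zero.mpr hd0⟩))))
  -- Step 5: `φ t₁ = t₁`, `φ ζ = ζ⁵`, hence `ℓ ≡ 5 (12)`
  have hsub : ({t₁, ζ} : Set (AlgebraicClosure ℚ)) ⊆
      IntermediateField.adjoin ℚ ({t₁, ζ} : Set (AlgebraicClosure ℚ)) :=
    IntermediateField.subset_adjoin ℚ _
  have hφt : φ • t₁ = t₁ := by
    have h := hfix t₁ (hsub (Set.mem_insert t₁ {ζ}))
    calc φ • t₁ = (φ * σ⁻¹) • (σ • t₁) := by rw [mul_smul, inv_smul_smul]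
      _ = t₁ := by rw [hσt, h]
  have hφζ : φ • ζ = ζ ^ 5 := by
    have h := hfix (ζ ^ 5) (pow_mem (hsub (Set.mem_insert_of_mem t₁ rfl)) 5)
    calc φ • ζ = (φ * σ⁻¹) • (σ • ζ) := by rw [mul_smul, inv_smul_smul]
      _ = ζ ^ 5 := by rw [hσζ, h]
  have h12 : ℓ % 12 = 5 := mod_twelve_eq_five hℓ2 hℓ3 hv h𝔓 hφ hζ hφζ
  -- Step 6: `β ≡ b ∈ ℤ (mod 𝔓)`
  set B : absIntegers (𝓞 ℚ) ℚ := ⟨β, hβint⟩ with hB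
  have hφB : φ • B = B := Subtype.ext (by
    rw [integralClosure.coe_smul]
    show φ • β = β
    rw [hβ, smul_mul', hφt, absoluteGaloisGroup.smul_def, map_intCast])
  obtain ⟨b, hb⟩ := helper_exists_int_congr_of_frob_fixed h𝔓 hφ B hφB
  -- Step 7: `ℓ ∣ N6(b, n)` in `ℤ`
  haveI : 𝔓.IsMaximal := HeightOneSpectrum.isMaximal_of_mem_primesAbove h𝔓
  have hinj : Function.Injective (algebraMap (absIntegers (𝓞 ℚ) ℚ) (AlgebraicClosure ℚ)) :=
    Subtype.val_injective
  have hN6B : N6 (c₄ : absIntegers (𝓞 ℚ) ℚ) c₆ B n = 0 := by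
    apply hinj
    rw [map_N6, map_intCast, map_intCast, map_intCast, map_zero]
    exact hN6β
  have hN6b : (ℓ : ℤ) ∣ N6 c₄ c₆ b n := by
    have h1 : Ideal.Quotient.mk 𝔓 (N6 (c₄ : absIntegers (𝓞 ℚ) ℚ) c₆ (b : absIntegers (𝓞 ℚ) ℚ) n) = 0 := by
      rw [← mk_N6_congr 𝔓 hb, hN6B, map_zero]
    rw [Ideal.Quotient.eq_zero_iff_mem, ← intCast_N6, intCast_mem_iff_dvd h𝔓] at h1
    exact h1
  -- Step 8: `ℓ ∤ N4(b, n)` in `ℤ`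
  have hN4b : ¬ (ℓ : ℤ) ∣ N4 c₄ c₆ b n := by
    intro hdvd
    have h1 : ((N4 c₄ c₆ b n : ℤ) : absIntegers (𝓞 ℚ) ℚ) ∈ 𝔓 := (intCast_mem_iff_dvd h𝔓 _).mpr hdvd
    have h2 : N4 (c₄ : absIntegers (𝓞 ℚ) ℚ) c₆ B n ∈ 𝔓 := by
      rw [← Ideal.Quotient.eq_zero_iff_mem, mk_N4_congr 𝔓 hb, Ideal.Quotient.eq_zero_iff_mem,
        ← intCast_N4]
      exact h1
    -- `x · (d x⁻¹) = d ∈ 𝔓`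
    have hX : (⟨x, by rw [hx]; exact (N4 (c₄ : absIntegers (𝓞 ℚ) ℚ) c₆ B n).2⟩ :
        absIntegers (𝓞 ℚ) ℚ) = N4 (c₄ : absIntegers (𝓞 ℚ) ℚ) c₆ B n := by
      apply hinj
      rw [map_N4, map_intCast, map_intCast, map_intCast]
      rfl
    have h3 : ((d : ℤ) : absIntegers (𝓞 ℚ) ℚ) ∈ 𝔓 := by
      have hprod : ((d : ℤ) : absIntegers (𝓞 ℚ) ℚ) =
          N4 (c₄ : absIntegers (𝓞 ℚ) ℚ) c₆ B n * ⟨(d : AlgebraicClosure ℚ) * x⁻¹, hyint⟩ := by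
        rw [← hX]
        apply Subtype.ext
        simp only [MulMemClass.coe_mul]
        rw [mul_comm, mul_assoc, inv_mul_cancel₀ hx0, mul_one]
        rfl
      rw [hprod]
      exact 𝔓.mul_mem_right _ h2
    exact hℓd ((intCast_mem_iff_dvd h𝔓 d).mp h3)
  -- Step 9: descend to `𝔽_ℓ` with `t ≡ b n⁻¹`
  have hnF : (n : ZMod ℓ) ≠ 0 := by rwa [Ne, ZMod.intCast_zmod_eq_zero_iff_dvd]
  have h17424 : (17424 : ZMod ℓ) ≠ 0 := by
    have h2 : (2 : ZMod ℓ) ≠ 0 := by exact_mod_cast natCast_ne_zero_of_prime_ne Nat.prime_two hℓ2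
    have h3 : (3 : ZMod ℓ) ≠ 0 := by exact_mod_cast natCast_ne_zero_of_prime_ne Nat.prime_three hℓ3
    have h11 : (11 : ZMod ℓ) ≠ 0 := by
      exact_mod_cast natCast_ne_zero_of_prime_ne (by norm_num) hℓ11
    rw [show (17424 : ZMod ℓ) = 2 ^ 4 * 3 ^ 2 * 11 ^ 2 by norm_num]
    exact mul_ne_zero (mul_ne_zero (pow_ne_zero _ h2) (pow_ne_zero _ h3)) (pow_ne_zero _ h11)
  have h240 : (240 : ZMod ℓ) ≠ 0 := by
    have h2 : (2 : ZMod ℓ) ≠ 0 := by exact_mod_cast natCast_ne_zero_of_prime_ne Nat.prime_two hℓ2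
    have h3 : (3 : ZMod ℓ) ≠ 0 := by exact_mod_cast natCast_ne_zero_of_prime_ne Nat.prime_three hℓ3
    have h5 : (5 : ZMod ℓ) ≠ 0 := by exact_mod_cast natCast_ne_zero_of_prime_ne Nat.prime_five hℓ5
    rw [show (240 : ZMod ℓ) = 2 ^ 4 * 3 * 5 by norm_num]
    exact mul_ne_zero (mul_ne_zero (pow_ne_zero _ h2) h3) h5
  set t : ℤ := b * (((n : ZMod ℓ)⁻¹).val : ℕ) with ht
  have htF : (n : ZMod ℓ) * (t : ZMod ℓ) = b := by
    rw [ht]; push_cast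
    rw [ZMod.natCast_zmod_val, mul_left_comm, mul_inv_cancel₀ hnF, mul_one]
  refine ⟨ℓ, hℓ, hℓS, h12, t, ?_, ?_⟩
  · -- `n³⁰ N6(t,1) = N6(nt, n) = N6(b, n) = 0`
    have h1 : N6 (c₄ : ZMod ℓ) c₆ ((n : ZMod ℓ) * t) n = 0 := by
      rw [htF]
      have := (ZMod.intCast_zmod_eq_zero_iff_dvd _ ℓ).mpr hN6b
      rwa [intCast_N6] at this
    rw [N6_smul_one] at h1
    rw [C6_eq_N6_div' _ _ _ _ h17424 h240,
      (mul_eq_zero.mp h1).resolve_left (pow_ne_zero _ hnF), zero_div]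
  · -- `n²⁰ N4(t,1) = N4(b, n) ≢ 0`
    intro h0
    apply hN4b
    rw [← ZMod.intCast_zmod_eq_zero_iff_dvd, intCast_N4, ← htF, N4_smul_one]
    rw [C4_eq_N4_div, div_eq_zero_iff] at h0
    rw [h0.resolve_right h17424, mul_zero]

end G3


/-! # §4 Generation-4 blocks, verbatim (`…StubSwitchK3g4`): transport, `Core1728`, T3, N3, Dirichlet, tail, assembly -/

/-- PROVED (gen 1): transport of a framed `5`-torsion model along a `5`-congruence. [folklore] -/
private theorem isTorsionGaloisRep_of_congr {W W' : WeierstrassCurve ℚ} (h : Congr W' W)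
    {ρ : ModPGaloisRep ℚ (ZMod 5) 2} (hρ : W.IsTorsionGaloisRep 5 ρ) :
    W'.IsTorsionGaloisRep 5 ρ := by
  obtain ⟨e', he'⟩ := h
  obtain ⟨e, he⟩ := hρ
  refine ⟨e'.trans e, fun σ P => ?_⟩
  rw [AddEquiv.trans_apply, AddEquiv.trans_apply, he', he]

/-- PROVED (k1-g3): a nonzero integer of absolute value below `q` is not divisible by `q`. [folklore] -/
private theorem not_dvd_of_natAbs_lt {q : ℕ} {z : ℤ} (hz : z ≠ 0) (hlt : z.natAbs < q) : ¬ (q : ℤ) ∣ z := by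
  intro h
  have h1 : q ∣ z.natAbs := by
    rcases h with ⟨k, hk⟩
    exact ⟨k.natAbs, by rw [hk, Int.natAbs_mul, Int.natAbs_natCast]⟩
  exact absurd (Nat.le_of_dvd (Int.natAbs_pos.mpr hz) h1) (not_le.mpr hlt)


/-! ## §3 Helpers -/

/-- T3 (PROVED, verbatim g3): `τ ζ₁₂ = ζ₁₂⁵` for `τ` negating `√-3` and fixing `μ₄`. [folklore] -/
private theorem smul_zeta12 (τ : Field.absoluteGaloisGroup ℚ)
    (hs : ∀ s : AlgebraicClosure ℚ, s ^ 2 = -3 → τ • s = -s)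
    (hi : ∀ z : AlgebraicClosure ℚ, z ^ 4 = 1 → τ • z = z)
    (ζ : AlgebraicClosure ℚ) (hζ : IsPrimitiveRoot ζ 12) : τ • ζ = ζ ^ 5 := by
  have h12 : ζ ^ 12 = 1 := hζ.pow_eq_one
  have hω1 : ζ ^ 4 ≠ 1 := fun h => by
    have := (hζ.pow_eq_one_iff_dvd 4).mp h
    omega
  have hquad : (ζ ^ 4) ^ 2 + ζ ^ 4 + 1 = 0 := by
    have h0 : (ζ ^ 4 - 1) * ((ζ ^ 4) ^ 2 + ζ ^ 4 + 1) = 0 := by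
      have : (ζ ^ 4) ^ 3 = 1 := by rw [← pow_mul]; exact h12
      linear_combination this
    exact (mul_eq_zero.mp h0).resolve_left (sub_ne_zero.mpr hω1)
  have hsq : (ζ ^ 4 + ζ ^ 4 + 1) ^ 2 = -3 := by linear_combination 4 * hquad
  have H1 := hs _ hsq
  rw [smul_add, smul_add, smul_one] at H1
  have hτω : τ • ζ ^ 4 = (ζ ^ 4) ^ 2 := by
    linear_combination (1 / 2 : AlgebraicClosure ℚ) * H1 - hquad
  have hτ9 : τ • ζ ^ 9 = ζ ^ 9 := hi _ (by
    rw [← pow_mul, show 9 * 4 = 12 * 3 by norm_num, pow_mul, h12, one_pow])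
  have hζ13 : ζ ^ 9 * ζ ^ 4 = ζ := by
    rw [← pow_add, show 9 + 4 = 12 + 1 by norm_num, pow_add, h12, one_mul, pow_one]
  calc τ • ζ = τ • (ζ ^ 9 * ζ ^ 4) := by rw [hζ13]
    _ = ζ ^ 9 * (ζ ^ 4) ^ 2 := by rw [smul_mul', hτ9, hτω]
    _ = ζ ^ 5 := by
        rw [← pow_mul, ← pow_add, show 9 + 4 * 2 = 12 + 5 by norm_num, pow_add, h12, one_mul]

open _root_.Literature.NumberTheory.QuadraticFields.GaussianPrimary _root_.Literature.NumberTheory.EllipticCurves.GaussianQuartic in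
/-- **N3 (S, NEW, PROVED): `3 ∤ #E(𝔽_ℓ)` for `E : y² = x³ + ax`, `a ≠ 0`, `ℓ ≡ 5 (mod 12)`.**
Gauss / Ireland–Rosen 18 §4 Thm 5 (tree PROVED `IrelandRosen1990_card_points_one_mod_four_holds`):
`#E(𝔽_ℓ) = ℓ + 1 − 2 Re π'`, `π' ∈ ℤ[i]`, `N(π') = ℓ`; `ℓ ≡ 2 (mod 3)` forces `3 ∤ Re π'`
(`x² + y² ≡ 2 (3) ⇒ x ≢ 0`), and `3 ∣ ℓ + 1`.  (Elementary alternative: a point of order `3` would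
give `Ψ₃ = 3x⁴ + 6ax² − a² = 0`, i.e. `3(x²+a)² = (2a)²`, but `(3/ℓ) = −1`.)
[IrelandRosen1990 Ch. 18 §4 Thm 5; numerics `num/n3_check.py`: 0/3476 exceptions, `ℓ < 400`] [folklore] -/
private theorem not_three_dvd_natCard_j1728 {p : ℕ} [Fact p.Prime] (hp12 : p % 12 = 5) (a : ZMod p)
    (ha : a ≠ 0) : ¬ 3 ∣ Nat.card (⟨0, 0, 0, a, 0⟩ : WeierstrassCurve (ZMod p)).toAffine.Point := by
  have hp : p.Prime := Fact.out
  have hp1 : p % 4 = 1 := by omega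
  -- `a = -D̄`, `p ∤ D`
  set D : ℤ := -((a.val : ℤ)) with hD
  have hDp : (D : ZMod p) = -a := by rw [hD]; push_cast; rw [ZMod.natCast_zmod_val]
  have hDnd : ¬ (p : ℤ) ∣ D := by
    rw [← ZMod.intCast_zmod_eq_zero_iff_dvd, hDp, neg_eq_zero]; exact ha
  have hW : (⟨0, 0, 0, a, 0⟩ : WeierstrassCurve (ZMod p)) = ⟨0, 0, 0, -(D : ZMod p), 0⟩ := by
    rw [hDp, neg_neg]
  -- a primary `π` of norm `p`
  obtain ⟨u, v, huv⟩ := Nat.Prime.sq_add_sq (p := p) (by omega)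
  set π₀ : GaussianInt := ⟨u, v⟩ with hπ₀
  have hπ₀p : π₀.norm = p := by
    rw [Zsqrtd.norm_def, hπ₀]; push_cast; rw [← huv]; push_cast; ring
  have hpar : (π₀.re + π₀.im) % 2 = 1 := by
    rw [← norm_emod_two, hπ₀p]; exact_mod_cast (show (p : ℤ) % 2 = 1 by omega)
  set π : GaussianInt := primary π₀ with hπ
  have hπP : IsPrimary π := isPrimary_primary hpar
  have hπp : π.norm = p := by rw [hπ, norm_primary hpar, hπ₀p]
  have hπ1 : (⟨2, 2⟩ : GaussianInt) ∣ π - 1 := (isPrimary_iff_dvd π).mp hπP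
  -- `χ_π(D) = i^k`
  have hD0 : ((D : ℤ) : ZMod p) ≠ 0 := by rwa [Ne, ZMod.intCast_zmod_eq_zero_iff_dvd]
  obtain ⟨k, hk⟩ : ∃ k : ℕ, chi hp1 hπp (D : ZMod p) = ⟨0, 1⟩ ^ k := by
    rcases eq_of_isUnit (isUnit_chi hp1 hπp hD0) with h | h | h | h
    · exact ⟨0, by rw [h, pow_zero]⟩
    · exact ⟨2, by rw [h]; decide⟩
    · exact ⟨1, by rw [h, pow_one]⟩
    · exact ⟨3, by rw [h]; decide⟩
  have hkdvd : π ∣ (D : GaussianInt) ^ ((p - 1) / 4) - ⟨0, 1⟩ ^ k := by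
    apply dvd_of_red_eq_zero hπp
    have hred := (chi_eq_iff hp1 hπp hD0 (isUnit_I.pow k)).mp hk
    rw [map_sub, map_pow, map_intCast, show (p - 1) / 4 = p / 4 by omega, ← hred, sub_self]
  -- Ireland–Rosen 18.5: `N = p + 1 - 2 Re π'`, `N(π') = p`
  have hN := IrelandRosen1990_card_points_one_mod_four_holds hp1 hDnd hπp hπ1 hkdvd
  rw [← hW] at hN
  set π' : GaussianInt := star ((⟨0, 1⟩ : GaussianInt) ^ k) * π with hπ'
  have hu' : IsUnit (star ((⟨0, 1⟩ : GaussianInt) ^ k)) := (isUnit_I.pow k).star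
  have hπ'p : π'.norm = p := by
    rw [hπ', Zsqrtd.norm_mul, (Zsqrtd.norm_eq_one_iff' (by norm_num) _).mpr hu', one_mul, hπp]
  have hnorm : π'.re * π'.re + π'.im * π'.im = p := by
    have h := hπ'p
    rw [Zsqrtd.norm_def] at h
    linear_combination h
  -- reduce everything mod 3
  rintro ⟨c, hc⟩
  set N := Nat.card (⟨0, 0, 0, a, 0⟩ : WeierstrassCurve (ZMod p)).toAffine.Point with hNdef
  have hp3 : (p : ZMod 3) = 2 := by
    have h := ZMod.natCast_mod p 3
    rw [show p % 3 = 2 by omega] at h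
    exact_mod_cast h.symm
  have e1 : ((π'.re : ℤ) : ZMod 3) * (π'.re : ZMod 3) + (π'.im : ZMod 3) * (π'.im : ZMod 3) = 2 := by
    have := congrArg (Int.cast : ℤ → ZMod 3) hnorm
    push_cast at this
    rw [hp3] at this
    exact this
  have e2 : (3 : ZMod 3) * (c : ZMod 3) = 2 + 1 - 2 * (π'.re : ZMod 3) := by
    have := congrArg (Int.cast : ℤ → ZMod 3) hN
    rw [hc] at this
    push_cast at this
    rw [hp3] at this
    exact this
  have fin : ∀ X Y C : ZMod 3, X * X + Y * Y = 2 → 3 * C = 2 + 1 - 2 * X → False := by decide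
  exact fin _ _ _ e1 e2

/-- G6c (PROVED, Dirichlet: `Nat.forall_exists_prime_gt_and_eq_mod`). [folklore] -/
private theorem exists_prime_five_mod_twelve_gt (n : ℕ) : ∃ ℓ : ℕ, ℓ.Prime ∧ n < ℓ ∧ ℓ % 12 = 5 := by
  have h5 : IsUnit ((5 : ℕ) : ZMod 12) := by decide
  obtain ⟨ℓ, hgt, hp, hmod⟩ := Nat.forall_exists_prime_gt_and_eq_mod h5 n
  refine ⟨ℓ, hp, hgt, ?_⟩
  have := (ZMod.natCast_eq_natCast_iff' ℓ 5 12).1 hmod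
  simpa using this

/-! ## §4 The ORDER-8 TAIL (PROVED from N3 + tree theorems, F2 as hypothesis) -/

/-- **The tail.**  An integral short model `E_{A,B}` that is `5`-congruent to `W`, and a prime
`ℓ ≡ 5 (12)` with `ℓ ∤ A`, `ℓ ∣ B`: then a global minimal model `W'` of `E_{A,B}` answers the stub —
`W'[5] ≅ ρ`, and every framed `W'[3]` is absolutely irreducible over `ℚ(√-3)`.  Chain (all tree,
PROVED): `hasGlobalMinimalModel_rat_holds`; `int_Δ` (`Δ ≡ −64A³ ≢ 0`);
`frobeniusTrace_eq_of_smul_eq_shortWeierstrass` (`a_ℓ(W') = ℓ + 1 − #Ē_{A,B}(𝔽_ℓ)`);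
N3 (`3 ∤ #`, and `3 ∣ ℓ + 1`); `hasGoodReductionAtPrime_shortWeierstrass_of_not_dvd_Δ` +
`hasGoodReductionAtPrime_smul_iff`; F2. [cite: ConradDiamondTaylor1999, proof of Thm. 7.1.2 (p. 556)] -/
private theorem tail (hF2 : ∀ W, FrobeniusCertificate W) (W : WeierstrassCurve ℚ) [W.IsElliptic] (A B : ℤ)
    [(shortWeierstrass (A, B)).IsElliptic] (hEW : Congr (shortWeierstrass (A, B)) W)
    (ℓ : ℕ) [Fact ℓ.Prime] (h12 : ℓ % 12 = 5) (hA : ¬ (ℓ : ℤ) ∣ A) (hB : (ℓ : ℤ) ∣ B)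
    (ρ : ModPGaloisRep ℚ (ZMod 5) 2) (hρ : W.IsTorsionGaloisRep 5 ρ) :
    ∃ (W' : WeierstrassCurve ℚ) (_ : W'.IsElliptic), W'.IsTorsionGaloisRep 5 ρ ∧
      ∃ ρ₃' : ModPGaloisRep ℚ (ZMod 3) 2, W'.IsTorsionGaloisRep 3 ρ₃' ∧
        ρ₃'.IsAbsIrreducibleOverSqrt (-3) := by
  set E : WeierstrassCurve ℚ := shortWeierstrass (A, B) with hE
  obtain ⟨C, hmin⟩ := hasGlobalMinimalModel_rat_holds E
  haveI := hmin
  have hsmul : C⁻¹ • (C • E) = shortWeierstrass (A, B) := inv_smul_smul C E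
  have hℓ1 : ℓ % 4 = 1 := by omega
  have h2 : (2 : ZMod ℓ) ≠ 0 := GaussianQuartic.two_ne_zero_of_one_mod_four hℓ1
  have hA' : (A : ZMod ℓ) ≠ 0 := by rwa [Ne, ZMod.intCast_zmod_eq_zero_iff_dvd]
  have hB' : (B : ZMod ℓ) = 0 := by rwa [ZMod.intCast_zmod_eq_zero_iff_dvd]
  -- `ℓ ∤ Δ(A,B) = -16(4A³ + 27B²) ≡ -64A³`
  have hΔ : ¬ (ℓ : ℤ) ∣ (⟨0, 0, 0, (A, B).1, (A, B).2⟩ : WeierstrassCurve ℤ).Δ := by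
    rw [int_Δ, ← ZMod.intCast_zmod_eq_zero_iff_dvd]
    push_cast
    rw [hB']
    have : (-16 : ZMod ℓ) * (4 * (A : ZMod ℓ) ^ 3 + 27 * (0 : ZMod ℓ) ^ 2) =
        -(2 ^ 6 * (A : ZMod ℓ) ^ 3) := by ring
    rw [this, neg_eq_zero]
    exact mul_ne_zero (pow_ne_zero _ h2) (pow_ne_zero _ hA')
  -- `a_ℓ(W') = ℓ + 1 − #Ē_{A,B}(𝔽_ℓ)` and the reduction is `y² = x³ + Āx`
  have hft : (C • E).frobeniusTrace ℓ =
      Literature.NumberTheory.Automorphic.frobeniusTrace ⟨0, 0, 0, A, B⟩ ℓ :=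
    frobeniusTrace_eq_of_smul_eq_shortWeierstrass (W := C • E) (AB := (A, B)) hsmul ℓ hΔ
  have hmap : (⟨0, 0, 0, A, B⟩ : WeierstrassCurve ℤ).map (Int.castRingHom (ZMod ℓ)) =
      ⟨0, 0, 0, (A : ZMod ℓ), 0⟩ := by
    ext <;> simp [WeierstrassCurve.map, hB']
  have hN3 := not_three_dvd_natCard_j1728 (p := ℓ) h12 (A : ZMod ℓ) hA'
  have h3ft : ¬ (3 : ℤ) ∣ (C • E).frobeniusTrace ℓ := by
    rw [hft, Literature.NumberTheory.Automorphic.frobeniusTrace,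
      Literature.NumberTheory.Automorphic.numPointsMod, hmap]
    intro h
    apply hN3
    have h3ℓ : (3 : ℤ) ∣ (ℓ : ℤ) + 1 := by
      have : 3 ∣ ℓ + 1 := Nat.dvd_of_mod_eq_zero (by omega)
      exact_mod_cast Int.natCast_dvd_natCast.mpr this
    have hN := (Int.dvd_sub h3ℓ h)
    rw [sub_sub_cancel] at hN
    exact Int.natCast_dvd_natCast.mp hN
  -- good reduction at `ℓ`
  have hgood : (C • E).HasGoodReductionAtPrime ℓ :=
    (hasGoodReductionAtPrime_smul_iff E C ℓ).mpr
      (hasGoodReductionAtPrime_shortWeierstrass_of_not_dvd_Δ (AB := (A, B)) ℓ hΔ)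
  have h3 : ℓ % 3 = 2 := by omega
  obtain ⟨ρ₃, hρ₃⟩ := (C • E).exists_isTorsionGaloisRep 3
  have hirr := hF2 (C • E) ℓ h3 hgood h3ft ρ₃ hρ₃
  have hcongr : Congr (C • E) W := congr_trans (congr_symm (congr_smul E C)) hEW
  exact ⟨C • E, inferInstance, isTorsionGaloisRep_of_congr hcongr hρ, ρ₃, hρ₃, hirr⟩

/-! ## §5 Assembly: Fisher (i) + Core1728 + F2 (+ G3, G2, G6, N3) ⇒ the stub, no hypothesis at `3` -/

/-- **The line (generation 4).**  `W ↦ W♭ = base(c₄,c₆)` (G6); `c₆ = 0`: `W♭ = E_{−27c₄,0}` itself,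
any Dirichlet prime `ℓ ≡ 5 (12)` above `27|c₄|`; `c₆ ≠ 0`: `Core1728 → T3 → G3 → G2 → Fisher (i)`;
both branches end in `tail`.  NONE of the stub's hypotheses (`27 ∤ N`, no abs. irreducible `ρ̄₃`,
`ρ̄₅` abs. irreducible) is used. [cite: ConradDiamondTaylor1999, proof of Thm. 7.1.2 (p. 556)] -/
private theorem stub_switch_of_core_and_tail (hF : Literature.NumberTheory.EllipticCurves.KleinQuinticTorsion.thm132_restricted)
    (hCore : Descent.Core1728) (hF2 : ∀ W, FrobeniusCertificate W) : CDT_three_five_switch := by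
  intro W _ _ _ ρ hρ _
  -- integral `c₄c₆`-model
  obtain ⟨u, c₄, c₆, hu, h4, h6⟩ := exists_integral_scaling W.c₄ W.c₆
  obtain ⟨Cv, hCv⟩ := base_scaled W hu h4 h6
  haveI hBell : (base (c₄ : ℚ) c₆).IsElliptic := by rw [← hCv]; infer_instance
  have hcongrB : Congr (base (c₄ : ℚ) c₆) W := congr_symm (congr_of_smul_eq Cv hCv)
  have hcQ : (c₄ : ℚ) ^ 3 ≠ (c₆ : ℚ) ^ 2 := by
    intro h
    have h1728 : (1728 : ℚ) * (base (c₄ : ℚ) c₆).Δ =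
        (base (c₄ : ℚ) c₆).c₄ ^ 3 - (base (c₄ : ℚ) c₆).c₆ ^ 2 := (base (c₄ : ℚ) c₆).c_relation
    have hc4 : (base (c₄ : ℚ) c₆).c₄ = 6 ^ 4 * c₄ := by
      simp only [WeierstrassCurve.c₄, WeierstrassCurve.b₂, WeierstrassCurve.b₄]; ring
    have hc6 : (base (c₄ : ℚ) c₆).c₆ = 6 ^ 6 * c₆ := by
      simp only [WeierstrassCurve.c₆, WeierstrassCurve.b₂, WeierstrassCurve.b₄, WeierstrassCurve.b₆]; ring
    rw [hc4, hc6, mul_pow, mul_pow, h, show ((6 : ℚ) ^ 4) ^ 3 = (6 ^ 6) ^ 2 by norm_num, ← sub_mul,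
      sub_self, zero_mul] at h1728
    exact (base (c₄ : ℚ) c₆).isUnit_Δ.ne_zero (by simpa using h1728)
  have hc : c₄ ^ 3 ≠ c₆ ^ 2 := fun h => hcQ (by exact_mod_cast h)
  by_cases hc₆ : c₆ = 0
  · -- `j(W) = 1728`: `W♭ = E_{−27c₄, 0}` itself
    subst hc₆
    have hc₄ : c₄ ≠ 0 := by rintro rfl; exact hc (by norm_num)
    have hz : (-27 * c₄ : ℤ) ≠ 0 := by omega
    obtain ⟨ℓ, hℓ, hgt, h12⟩ := exists_prime_five_mod_twelve_gt (-27 * c₄).natAbs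
    haveI : Fact ℓ.Prime := ⟨hℓ⟩
    have hbase : base (c₄ : ℚ) ((0 : ℤ) : ℚ) = shortWeierstrass (-27 * c₄, 0) := by
      ext <;> simp [shortWeierstrass]
    haveI : (shortWeierstrass (-27 * c₄, 0)).IsElliptic := by rw [← hbase]; exact hBell
    have hcongrE : Congr (shortWeierstrass (-27 * c₄, 0)) W := by rw [← hbase]; exact hcongrB
    exact tail hF2 W (-27 * c₄) 0 hcongrE ℓ h12 (not_dvd_of_natAbs_lt hz hgt) (dvd_zero _) ρ hρ
  · -- generic case: the twisted `1728`-fibre (Core1728) read at a Chebotarev prime `ℓ ≡ 5 (12)`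
    obtain ⟨τ, t₁, hs, hi, ht6, ht4, hfix⟩ := hCore c₄ c₆ hc hc₆
    obtain ⟨ζ, hζ⟩ := HasEnoughRootsOfUnity.exists_primitiveRoot (AlgebraicClosure ℚ) 12
    have hτζ : τ • ζ = ζ ^ 5 := smul_zeta12 τ hs hi ζ hζ
    obtain ⟨ℓ, hℓF, hℓS, h12, t, ht6', ht4'⟩ :=
      exists_prime_five_mod_twelve_root c₄ c₆ hc t₁ ζ ht6 ht4 hζ τ hfix hτζ {2, 3, 5, 11}
    haveI := hℓF
    obtain ⟨A, B, Cv', hCv', hA4, hB6⟩ := member_integral_short_mod ℓ hℓS c₄ c₆ t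
    have hA : ¬ (ℓ : ℤ) ∣ A := by
      rw [← ZMod.intCast_zmod_eq_zero_iff_dvd, hA4]; exact ht4'
    have hB : (ℓ : ℤ) ∣ B := by
      rw [← ZMod.intCast_zmod_eq_zero_iff_dvd, hB6]; exact ht6'
    -- `E_{A,B}` is elliptic: `4A³ + 27B² ≡ 4A³ ≢ 0 (mod ℓ)`
    have hℓ1 : ℓ % 4 = 1 := by omega
    have h2 : (2 : ZMod ℓ) ≠ 0 := GaussianQuartic.two_ne_zero_of_one_mod_four hℓ1
    have hA' : (A : ZMod ℓ) ≠ 0 := by rwa [Ne, ZMod.intCast_zmod_eq_zero_iff_dvd]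
    have hB' : (B : ZMod ℓ) = 0 := by rwa [ZMod.intCast_zmod_eq_zero_iff_dvd]
    have hne : 4 * (A, B).1 ^ 3 + 27 * (A, B).2 ^ 2 ≠ 0 := by
      intro h0
      have h0' := congrArg (Int.cast : ℤ → ZMod ℓ) h0
      push_cast at h0'
      rw [hB'] at h0'
      have : (4 : ZMod ℓ) * (A : ZMod ℓ) ^ 3 + 27 * (0 : ZMod ℓ) ^ 2 = 2 ^ 2 * (A : ZMod ℓ) ^ 3 := by ring
      rw [this] at h0'
      exact mul_ne_zero (pow_ne_zero _ h2) (pow_ne_zero _ hA') h0'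
    haveI hEell : (shortWeierstrass (A, B)).IsElliptic := isElliptic_of_ne_zero hne
    set E' : WeierstrassCurve ℚ := member c₄ c₆ t 1 with hE'
    haveI hE'ell : E'.IsElliptic := by
      have : E' = Cv'⁻¹ • shortWeierstrass (A, B) := by rw [← hCv', inv_smul_smul]
      rw [this]; infer_instance
    obtain ⟨e, he⟩ := hF (base (c₄ : ℚ) c₆) E' (c₄ : ℚ) (c₆ : ℚ) (t : ℚ) 1 (by exact_mod_cast hc₆) rfl rfl
    have hcongrE : Congr (shortWeierstrass (A, B)) W :=
      congr_trans (congr_symm (congr_of_smul_eq Cv' hCv')) (congr_trans ⟨e, he⟩ hcongrB)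
    exact tail hF2 W A B hcongrE ℓ h12 hA hB ρ hρ

/-! ## §11 Generation 11 bottom line: F2, G2, G3, G6 discharged -/

/-- **The k3 road after generation 11.**  Only Fisher 13.2 (i) (named fact F1) and `Core1728`
(THEOREM `Descent.Core1728_holds`, module `CDTThreeFiveSwitchDescent`) remain as
hypotheses; `CDT_three_five_switch` is `Sketch.stub_switch` by `Iff.rfl`. [cite: ConradDiamondTaylor1999, proof of Thm. 7.1.2 (p. 556)] -/
private theorem stub_switch_of_fisher_and_core (hF : Literature.NumberTheory.EllipticCurves.KleinQuinticTorsion.thm132_restricted)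
    (hCore : Descent.Core1728) (hF2 : ∀ W, FrobeniusCertificate W) : CDT_three_five_switch :=
  stub_switch_of_core_and_tail hF hCore hF2

end

end Literature.NumberTheory.Automorphic.CDTThreeFiveSwitch.Road


namespace Literature.NumberTheory.Automorphic.CDTThreeFiveSwitch.Road

/-- **THE k3 ROAD, CLOSED MODULO F1.**  Fisher's Theorem 13.2 (i) for the Hesse family of degree `5`
(tree named fact `HesseFamilyFive.thm132_geomTorsionFive_of_hesseFamily`, statement-only) implies
Wiles' `3–5` switch `BCDT.CDT_three_five_switch` (= `Sketch.stub_switch`, `Iff.rfl`): g10's THEOREM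
`Core1728` + this generation's F2/G2/G3/G6 + g4's tail. [cite: ConradDiamondTaylor1999, proof of Thm. 7.1.2 (p. 556)] -/
private theorem CDT_three_five_switch_of_thm132
    (hF : Literature.NumberTheory.EllipticCurves.KleinQuinticTorsion.thm132_restricted)
    (hF2 : ∀ W, FrobeniusCertificate W) :
    Literature.NumberTheory.Automorphic.BCDT.CDT_three_five_switch :=
  stub_switch_of_fisher_and_core hF Descent.Core1728_holds hF2

/-- **Wiles' `3`–`5` switch `BCDT.CDT_three_five_switch` from the order-`8` group criterion** (`h8c`, kept as an
explicit input: it is the tree's `ModThreeOrderEight.orderEightCriterion`, fed in `BCDT.CDT_three_five_switch_holds` below):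
Fisher 13.2 (i) restricted (`KleinQuinticTorsion.thm132_restricted_holds`) + Klein descent (`Descent.Core1728_holds`)
+ this file's F2/G2/G3/G6/tail. [cite: ConradDiamondTaylor1999, proof of Thm. 7.1.2 (p. 556)] -/
theorem CDT_three_five_switch_of_orderEightCriterion
    (h8c : ∀ (ρ : ModPGaloisRep ℚ (ZMod 3) 2),
      (∀ σ : Field.absoluteGaloisGroup ℚ, Matrix.GeneralLinearGroup.det (ρ σ) =
        Literature.NumberTheory.GaloisRepresentations.modPCyclotomicCharacterZMod ℚ 3 σ) →
      ∀ σ₀ : Field.absoluteGaloisGroup ℚ, orderOf (ρ σ₀) = 8 → ρ.IsAbsIrreducibleOverSqrt (-3)) :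
    Literature.NumberTheory.Automorphic.BCDT.CDT_three_five_switch :=
  CDT_three_five_switch_of_thm132 Literature.NumberTheory.EllipticCurves.KleinQuinticTorsion.thm132_restricted_holds
    (frobeniusCertificate_of_orderEightCriterion h8c)

end Literature.NumberTheory.Automorphic.CDTThreeFiveSwitch.Road

namespace Literature.NumberTheory.Automorphic.BCDT

/-- **Wiles' `3`–`5` switch from a curve (CDT 1999, proof of Thm. 7.1.2, p. 556) — the named fact
`BCDT.CDT_three_five_switch` DISCHARGED**: for `E/ℚ` with `27 ∤ N_E`, no framed model of `E[3]`
absolutely irreducible over `ℚ(√-3)`, and a framed model `ρ̄` of `E[5]` absolutely irreducible over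
`ℚ(√5)`, some elliptic curve `E'/ℚ` has `E'[5] ≅ ρ̄` and a framed model of `E'[3]` absolutely
irreducible over `ℚ(√-3)`.  Proof: the road of this file fed with the group criterion
`ModThreeOrderEight.orderEightCriterion` (an element of order `8` and `det = χ̄₃` make `ρ̄|_{ℚ(√-3)}`
absolutely irreducible). [cite: ConradDiamondTaylor1999, proof of Thm. 7.1.2 (p. 556)] -/
theorem CDT_three_five_switch_holds : CDT_three_five_switch :=
  _root_.Literature.NumberTheory.Automorphic.CDTThreeFiveSwitch.Road.CDT_three_five_switch_of_orderEightCriterion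
    _root_.Literature.NumberTheory.GaloisRepresentations.ModThreeOrderEight.orderEightCriterion

end Literature.NumberTheory.Automorphic.BCDT

#print axioms Literature.NumberTheory.Automorphic.BCDT.CDT_three_five_switch_holds
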